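import Summits.AtomisticToContinuum.FouriersLaw.Theses.EmbeddedDrudeMourre
import Summits.AtomisticToContinuum.FouriersLaw.Theorems.DrudeDissolution.Negative.WeakAnharmonicityForm
import Summits.AtomisticToContinuum.FouriersLaw.Theorems.EmbeddedDrudeMourreMourreDissolutionSpectralWindow
import Summits.AtomisticToContinuum.FouriersLaw.Theorems.EmbeddedDrudeMourreFGRGap
import Literature.MathematicalPhysics.KineticTheory.ZeroWavenumberSpace
import Literature.MathematicalPhysics.KineticTheory.InfiniteChainInvariantStates
import Literature.MathematicalPhysics.KineticTheory.InfiniteChainSuperstableDynamics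
import Summits.AtomisticToContinuum.FouriersLaw.Theorems.EmbeddedDrudeMourreDrudeDissolutionStubPolynomialStationarity
import Summits.AtomisticToContinuum.FouriersLaw.Theorems.EmbeddedDrudeMourreDrudeDissolutionStubPencilDerivation
import Summits.AtomisticToContinuum.FouriersLaw.Theorems.EmbeddedDrudeMourreDrudeDissolutionStubPencilFramework
import Summits.AtomisticToContinuum.FouriersLaw.Theorems.EmbeddedDrudeMourreDrudeDissolutionStubGramContinuity
import Literature.MathematicalPhysics.KineticTheory.HarmonicChaosDecomposition
import Literature.MathematicalPhysics.KineticTheory.InfiniteChainGoodSetSymmetries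
import Literature.MathematicalPhysics.KineticTheory.InfiniteChainShiftInvariantUniqueness
import Summits.AtomisticToContinuum.FouriersLaw.Theorems.EmbeddedDrudeMourreDrudeDissolutionStubFreeForceKernelSpectral
import Summits.AtomisticToContinuum.FouriersLaw.Theorems.EmbeddedDrudeMourreDrudeDissolutionStubHarmonicPencilAlgebra
import Summits.AtomisticToContinuum.FouriersLaw.Theorems.EmbeddedDrudeMourreDrudeDissolutionStubWickShellDynamic
import Summits.AtomisticToContinuum.FouriersLaw.Theorems.EmbeddedDrudeMourreDrudeDissolutionStubWickShellStatic
import Summits.AtomisticToContinuum.FouriersLaw.Theorems.EmbeddedDrudeMourreDrudeDissolutionStubHarmonicStein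
import Summits.AtomisticToContinuum.FouriersLaw.Theorems.EmbeddedDrudeMourreDrudeDissolutionStubForceKernels
import Summits.AtomisticToContinuum.FouriersLaw.Theorems.EmbeddedDrudeMourreDrudeDissolutionStubForceWindow

/-!
# Line `gram-pencil-harmonic-chaos` — checked skeleton for the crux `DrudeDissolution`
(stmt-AtomisticToContinuum-12593, route `EmbeddedDrudeMourre`, sub-problem `FouriersLaw`; crux-plan
seat planner-cruxplan-stmt-AtomisticToContinuum-12593-gram-pencil-harmonic-0, 2026-08-16; idea card
`Cruxes/DrudeDissolution/Ideas/gram-pencil-harmonic-chaos.md` (ideator 1), triage r1-1/r1-2/r1-3: pass/pass/pass)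

Crux (FIXED, concluded below BY NAME):
`Summit.AtomisticToContinuum.FouriersLaw.Theses.EmbeddedDrudeMourre.DrudeDissolution` — for
`pinnedChain ω₂ lam β γ` (all four `> 0`) there is `T₀ > 0` such that every `T ∈ (0, T₀)` carries a DLR
Gibbs state `μ_T`, a `μ_T`-preserving infinite-volume dynamics with absolutely convergent summed current
correlations `C_T`, a finite measure `σ_T` with `C_T(t) = ∫ cos(ωt) dσ_T(ω)` and a window `(−δ, δ)` on
which `σ_T = g dω`, `g` continuous, `≥ 0`, `g 0 > 0` (the harmonic Drude atom DISSOLVED).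

## The idea, and how it becomes a line

By the landed Negative lemma `drudeDissolution_iff_weak_anharmonicity` (cdisprove §3d, file
`Theorems/DrudeDissolution/Negative/WeakAnharmonicityForm.lean`) the crux IS the statement that at unit
temperature every coupling ray `ε ↦ P_ε := pinnedChain ω₂ (aε) (bε) 1` (`a, b > 0`) has spectral
witnesses for all small `ε > 0`. The card's lever is the GRAM PENCIL on that ray: on the ε-INDEPENDENT
algebra `𝒫` of local polynomial observables (here: `Algebra.adjoin ℝ {σ ↦ q_x, σ ↦ p_x}`) the interacting
thermal Koopman structure is the pair

* `G_ε(u, v) = Σ_x Cov_{μ_ε}(u, v ∘ τ_x)` — Doyon's zero-wavenumber form of the UNIQUE shift-invariant DLR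
  state `μ_ε` of `P_ε` at `T = 1` (`OscillatorChain.eq_of_isChainGibbsMeasure_of_isShiftInvariant_pinnedChain`),
  continuous (indeed `C^∞`, not analytic — Dyson) in `ε ∈ [0, 1]` on `𝒫 × 𝒫` — stub G;
* `𝓛_ε = liouvilleZ P_ε = 𝓛₀ + ε𝓛₁`, EXACTLY affine in `ε` (the forces of `pinnedChain` are affine in
  `(lam, β)`: §4 `example`s), mapping `𝒫 → 𝒫`, `G_ε`-skew by generator-sense stationarity on POLYNOMIALS
  (stub S), and equal to the Koopman generator on polynomial classes, the local classes forming a core (stub C),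

all living in ONE rich zero-wavenumber datum per `ε` whose observable space is spanned by the flow-orbit of
`𝒫` (stub F, the pencil's carrier; `ε = 0` included: the harmonic chain `pinnedChain ω₂ 0 0 1` has its
Buttà–Marchioro dynamics by `exists_bmDynamics` with `s₁ = s₂ = 1`). In this setting the Mori/Feshbach
memory function of the current is EXACTLY `ε²` times a resolvent matrix element between the FIXED vectors
`Φ = d/dε|₀ 𝓛_ε j^ε = 𝓛₁ j⁽²⁾ + b 𝓛₀ j⁽⁴⁾ ∈ 𝒫` (`𝓛₀ j⁽²⁾ = k₀ − k₁` is a coboundary: cdisprove §4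
`hasDerivAt_bondCurrentZ_harmonic`), and its leading term is GAUSSIAN: the free force kernel
`K₀(t) = G₀(Φ, Φ ∘ φ⁰_t)` of the harmonic chain, whose Abelian spectral function at frequency `0` exists,
is continuous through the pair threshold and is POSITIVE there (`= const · q_{ω₂,a,b}(f_J)`, ALS's collision
form on the current profile: the dictionary line "Fermi golden rule = `boltzmannForm`", positivity from the
PROVED odd-sector gap `FGRGap_proof`) — stub K, the line's load-bearing checkable lemma. The ENGINE
(stub E, hardest, open-problem class) is what the triage said the pencil organises but does not shrink:
uniform-in-`ε` control of the reduced resolvent on the kinetic scale `|z| ≲ ε²` down to the real axis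
(Davies/van Hove limit of the memory function WITH boundary values), concluded operator-free as a locally
uniform Abelian limiting absorption statement for `C_ε` near frequency `0`; the composition feeds it F's
datum at `(aε, bε)`, the PROVED gap, and G, S, K, C by name, and closes with the landed Bochner/Stieltjes
window lemma `MourreDissolution.stub_spectralWindow` and the weak-anharmonicity form of the crux.

## File map

* §1 `Sig.stub_<name> : Prop` — the six stub STATEMENTS (F, C, G, S, K, E).
* §2 `theorem stub_<name> : <statement, expanded verbatim> := by sorry` — the registered stubs (the ONLY
  sorries of the file).
* §3 `DrudeDissolution_of : Sig.F → Sig.C → Sig.G → Sig.S → Sig.K → Sig.E → DrudeDissolution` — the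
  kernel-checked composition (no sorry of its own; the UNIQUE declaration concluding the crux), and an
  `example` instantiating it through the sorried stubs.
* §4 sanity `example`s (proved): the pencil is exactly affine in `ε` at the level of the forces and of the
  bond current; the Bochner inputs of the composition in the tree's spelling.

Dependency shape: E consumes F, C, G, S, K (its statement is `F → C → G → S → K → LAP`); the composition
instantiates F at `(aε, bε)` to get the datum `(D, Z)`, hands it with `HasOddSectorGap ω₂ a b`
(`FGRGap_proof`) to E, turns E's Abelian LAP plus the tree's Bochner inputs (`currentCorrelation_neg`,
`sum_mul_currentCorrelation_nonneg`, strong continuity) into the window density by `stub_spectralWindow`,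
and reads off the unit-temperature witness demanded by `drudeDissolution_iff_weak_anharmonicity`.

HARDEST stub: `stub_pencilDissolution` (E; open-problem class — the crux's analytic heart with the pencil's
inputs named). LOAD-BEARING FOR THE IDEA: `stub_freeForceKernel` (K) on the setting F + C.
Sizes: F L–XL (framework; every ingredient but polynomial clustering is in the tree), C L, G M–L, S M,
K L–XL (Wick dictionary + the threshold analysis of line swap-odd's stub B, 12594), E open.

## Disproof used (`Cruxes/DrudeDissolution/Disproof.lean`, cdisprove cycle 1, RESISTS; read 2026-08-16)

* §3d `drudeDissolution_iff_weak_anharmonicity` (landed, imported): the pencil parameter `ε` IS the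
  disprover's coupling-ray parameter at `T = 1`; the composition literally rewrites the crux by it — no
  rescaling of time or temperature anywhere in the line.
* §3a `drudeDissolution_false_without_temp_pos`: honoured — every stub is at `T = 1` (F, C, G, K, E) or
  at an explicit `T > 0` (S).
* §3b (`γ` is decoration): the line runs at `γ = 1` throughout, as the weak-anharmonicity form does.
* §3c `laxSpectralWitness_all` / `not_identity_flow` (junk witnesses): F pins the datum to the
  Buttà–Marchioro dynamics on `bmGood` (identity only OFF the full-measure good set) and a DLR state; E's
  `0 < g 0` is the load-bearing clause and is produced, not assumed.
* §4 `hasDerivAt_bondCurrentZ_harmonic` (`𝓛₀ j = k₀ − k₁`): the degenerate base point of the pencil — it is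
  why the memory function carries the exact factor `ε²` and why K's vector is the FIRST-order force `Φ`.
* §5 (window ⇏ `L¹`): nothing in the line claims `C_ε ∈ L¹`; E's conclusion is Abelian.
* No `-- Targets` section, no `stub_*_false`, no landed `Negative/` lemma refuting any statement of this
  shape (negatives index, 17 on the summit: on `FouriersLaw` only stmt-9139 `OddCorrectorDecay` and stmt-12890
  `FarFieldGaussianity`, neither of the shape of a stub here); no stub is an instance of a refuted statement. The interface caveat (existence of an INVARIANT dynamics is part of the crux) is met by F via the
  PROVED `OscillatorChain.exists_bmDynamics` (+ invariance of superstable DLR states), not assumed.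

## Triage answers (r1-1 / r1-2 / r1-3), acted on

* "not a line by itself — fold in as §0 of the picked engine line": the skeleton makes the pencil the §0
  (F, C, G, S) AND isolates the one pencil computation every engine on this crux and on 12594 starts from
  (K = the chain-side Feshbach identification the 12594 lead c6/c7 asked a planner to file: NOTES.md of crux
  MourreDissolution, "(ii) the FESHBACH IDENTIFICATION … is what any proof of S5 or S7 starts from"); the
  engine E is stated honestly as the open heart, exactly as swap-odd's D / separable-vertex's S5.
* r1-1 "quantify the First lemma over the unique shift-invariant tempered DLR state": G quantifies over
  families of shift-invariant DLR states (unique by `eq_of_isChainGibbsMeasure_of_isShiftInvariant_pinnedChain`;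
  superstability automatic, `hasSuperstabilityEstimate_of_isShiftInvariant_pinnedChain`).
* r1-1/r1-3 "clean at fixed z only; at |Im z| ≲ ε² the reduced resolvent is not an O(ε) perturbation":
  said so — it is E, named as such, with the fixed-`z` Trotter–Kato step and the kinetic-scale Davies limit
  recorded as its internal milestones (docstring of E), not hidden in K.
* r1-2 (iii)/r1-3 "work on 𝒟/ker G_ε, rank-stability of Gram blocks": the skeleton never identifies
  `𝒟/ker G_ε` across `ε`; it uses `ℋ₀(μ_ε)` per `ε` (F) and transports only NUMBERS `G_ε(u,v)` (G). The
  card's falsifier (a) is thereby defused rather than assumed.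
* r1-2 (iv)/r1-3 "state essential skew-adjointness of 𝓛_ε on 𝒟 as a stub": stub C (generator = `𝓛_ε`
  on polynomial classes + `LinearPMap.HasCore` for the local classes; the time-zero-polynomial core is an
  MPP-type statement, recorded in C's docstring as not needed and not claimed).
* r1-2 (ii) `noOddConservedGerm` (item (4) of the card): NOT a registered stub — it is a consequence of
  S + K + `FGRGap` at the germ level and is not consumed by the composition; recorded in the line card as
  the first `--supports` lemma of E (the virial step), so as not to file decoration.
## LEAD c11 RESHAPE (skeleton v4, 2026-08-17): K `stub_freeForceKernel` split into six registered sub-stubs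

K is no longer a stub: `stub_freeForceKernel` is PROVED below from K1 `stub_harmonicStein` (Stein/Isserlis moments of the
harmonic thermal state, via the landed S and lattice Green uniqueness), K2 `stub_wickShellStatic` (static zero-wavenumber form of
Wick monomials = zero-momentum shell integrals; held by the lead), KAlg `stub_harmonicPencilAlgebra` (`𝓛₀` on Wick products,
`w_{Lf} = −iω w_f`), K6 `stub_wickShellDynamic` (the harmonic spectral formula for Wick polynomials by ODE uniqueness in `ℋ₀`, on
top of the landed generator stub C — no pointwise identification of the Buttà–Marchioro flow is needed), KΦ `stub_forceKernels`
(Wick presentation of `Φ`; its chaos-2 zero-momentum kernels VANISH — no Drude atom —, its pair kernel is `−(3i/2)[sin]·vertex/Πω`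
up to `Ω·bounded`) and KT `stub_forceWindow` (datum-free: the explicit measure has a window density, continuous by the sibling crux
12594's LANDED slab/regular-value machinery — `slabNC_core` is stated for any weight `≤ C sin²((k₃−k₁)/2)sin²((k₂−k₃)/2)` — and
positive at `0` by the LANDED `fermiGoldenRule_threshold`/`thresholdDensity` with profile `sin` and `HasOddSectorGap`), glued by a
rigidity lemma (any K-datum has THE shift-invariant DLR state and the BM flow on `bmGood`, so its free force kernel is that of F's
canonical datum) proved in this file. The sector bookkeeping (multiplicities `1/12, 1/3, 1/4`; creation slots conjugated; sector
frequencies `Ω₄₀, Ω₃₁, Ω₂₂ = PinnedChainKinetic.resonanceFn`) was checked against exact Gaussian lattice sums to 12 digits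
(`work/scratch/check_shell(.t).py` of the lead's folder, static and `t = 0.7`). E is unchanged (the open engine).
-/

noncomputable section

namespace Summit.AtomisticToContinuum.FouriersLaw.Cruxes.DrudeDissolution.GramPencilHarmonicChaos

open MeasureTheory Filter Set Function Topology
open scoped InnerProductSpace ENNReal ComplexConjugate
open Literature.MathematicalPhysics.KineticTheory
open Literature.MathematicalPhysics.KineticTheory.HeatConduction
open Literature.MathematicalPhysics.KineticTheory.PhononBoltzmann
open HarmonicChaos ProbabilityTheory
open PinnedChainKinetic (𝕋 𝕋3 μ𝕋 μ𝕋3 k₄ sinT)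
open scoped Literature.MathematicalPhysics.KineticTheory.HeatConduction.PinnedChainKinetic

/-! ## §1 The six stub STATEMENTS

Conventions. Unit temperature `T = 1` and bath constant `γ = 1` throughout (the weak-anharmonicity
form of the crux). `𝒫 := Algebra.adjoin ℝ (range of the coordinate functions σ ↦ q_x, σ ↦ p_x)` — the
ε-independent *-algebra of LOCAL POLYNOMIAL observables — is written out in full at every occurrence (no
line-local definition enters a stub statement). The spatial reflection is `ι σ = σ(-·)`, inline. The
chains on the ray are `pinnedChain ω₂ (a * ε) (b * ε) 1`; the harmonic endpoint is `pinnedChain ω₂ 0 0 1`. -/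

/-- **Stub F — `stub_pencilFramework` (THE PENCIL'S CARRIER: A RICH SYMMETRIC ZERO-WAVENUMBER DATUM
WHOSE OBSERVABLES ARE THE FLOW-ORBIT OF THE LOCAL POLYNOMIALS, AT UNIT TEMPERATURE, FOR EVERY
`lam, β ≥ 0` — the harmonic endpoint included; size L–XL; non-perturbative; independent of `H`).**
For `ω₂ > 0`, `lam, β ≥ 0`: an infinite-volume dynamics `D` of `pinnedChain ω₂ lam β 1` with
`D.carrier = bmGood`, measurable flow, the IDENTITY off `bmGood` (normal form), commuting EVERYWHERE with
the lattice translations and with the spatial reflection `ι`; and a zero-wavenumber datum `Z` over `D` whose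
state is a DLR Gibbs state at `T = 1`, `ι`-invariant, with momentum reversal a symmetry of the datum,
strongly continuous Koopman group, and
`Z.localObs = span_ℝ {u ∘ φ_s : u ∈ 𝒫, s ∈ ℝ}` — so every local polynomial, at every time, has a class in
`ℋ₀(Z.μ)`, and `⟪[u], U_t[v]⟫₀ = Σ_x Cov(u, v ∘ τ_x ∘ φ_t)` (`form_eq_tsum`).
Why true / how: `D` = the symmetric Buttà–Marchioro group (`OscillatorChain.exists_bmDynamics` with
`(s₁, s₂) ∈ {1,2}²` according to `lam = 0 ∨ lam > 0`, `β = 0 ∨ β > 0`; everywhere symmetries as in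
`exists_symmetric_bmDynamics` / `InfiniteChainGoodSetSymmetries`); `Z.μ` = the transfer-operator Markov
state (`exists_gibbsFamily_pinnedChain`, `lam, β ≥ 0`; `ι`- and `R`-invariant by uniqueness
`eq_of_isChainGibbsMeasure_of_isShiftInvariant_pinnedChain`; preserved by `D`: last clause of
`exists_bmDynamics`); clustering of the generators `u ∘ τ_y ∘ φ_s`, `u ∈ 𝒫`: fixed-time `L²` locality of
`u ∘ φ_t` with summable rate (`InfiniteChainDynamics.exists_summable_l2_locality`, to be run for observables
depending on a box `[-R, R]` instead of `{-1,0,1}` — local polynomials are polynomially Lipschitz with all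
moments under (2.3), `exists_integral_abs_pow_add_le_pinnedChain`) + exponential ρ-mixing of the Markov state
(`exists_regular_state_mixing`) ⇒ `ℓ¹` clustering (`InfiniteChainClusteringTransfer`); assembly as in
`exists_zeroWavenumberData_of_clustering` (span of generators, `FluctuationClusteringSpan`,
`FluctuationFoelnerPositivity`); strong continuity from two-point continuity
(`FluctuationStrongContinuityGenerators` pattern). The new work is ONLY the passage from the two generators
`j₀, h₀` to all of `𝒫` (box-`R` locality and moments of arbitrary degree).
Why it might fail: only through an interface defect (e.g. a local polynomial of range `R` needs the light-cone
lemma for box-supported observables, presently stated for the sites `-1, 0, 1`).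
Role: the ONE space per `ε` on which `(G_ε, 𝓛_ε)` act; consumed by the composition (datum at `(aε,bε)`),
by E (hypothesis), and — at `(0,0)` — by E's prover to USE stub K.
Foreseen split (≤ 3): F-a dynamics + state + symmetries (tree assembly), F-b polynomial clustering ⇒ datum,
F-c strong continuity on the rich space.
Leans on: `InfiniteChainDynamics`, `OscillatorChain.bmGood`, `exists_bmDynamics`, `ZeroWavenumberData`
(+`HasMomentumReversal`, `FluctuationDynamics.IsStronglyContinuous`), `exists_gibbsFamily_pinnedChain`,
`exists_regular_state_mixing`, `exists_summable_l2_locality`, `exists_zeroWavenumberData_of_clustering`,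
`MourreDissolution.canonicalDatum` / `stub_zeroWavenumberFramework` (the `{j₀,h₀}` version, LANDED).
[cite: ButtaMarchioro2016, §2 Thm 2.1–2.2 and §3] [cite: Doyon2022, §4.1 Def. 4.3–4.4, Thm 4.11]
[cite: LanfordLebowitzLieb1977, §4] [cite: Georgii2011, Thm 10.25 and §11.1] -/
def Sig.stub_pencilFramework : Prop :=
    ∀ ω₂ lam β : ℝ, 0 < ω₂ → 0 ≤ lam → 0 ≤ β →
      ∃ (D : InfiniteChainDynamics (pinnedChain ω₂ lam β 1))
        (Z : ZeroWavenumberData (pinnedChain ω₂ lam β 1) D),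
          (pinnedChain ω₂ lam β 1).IsChainGibbsMeasure 1 Z.μ ∧
          D.carrier = (pinnedChain ω₂ lam β 1).bmGood ∧
          (∀ t : ℝ, Measurable (D.flow t)) ∧
          (∀ (t : ℝ) (σ : ChainConfig), σ ∉ (pinnedChain ω₂ lam β 1).bmGood → D.flow t σ = σ) ∧
          (∀ (t : ℝ) (x : ℤ), D.flow t ∘ chainShift x = chainShift x ∘ D.flow t) ∧
          (∀ t : ℝ, (fun (σ : ChainConfig) (i : ℤ) => σ (-i)) ∘ D.flow t = D.flow t ∘ (fun (σ : ChainConfig) (i : ℤ) => σ (-i))) ∧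
          MeasureTheory.MeasurePreserving (fun (σ : ChainConfig) (i : ℤ) => σ (-i)) Z.μ Z.μ ∧
          Z.HasMomentumReversal ∧
          Z.toFluctuationDynamics.IsStronglyContinuous ∧
          Z.localObs = Submodule.span ℝ {w : ChainConfig → ℝ | ∃ u ∈ Algebra.adjoin ℝ (Set.range fun xc : ℤ × Bool => fun σ : ChainConfig => if xc.2 then (σ xc.1).2 else (σ xc.1).1), ∃ s : ℝ, w = u ∘ D.flow s}

/-- **Stub C — `stub_pencilDerivation` (THE PENCIL'S DERIVATION: `𝓛_ε = liouvilleZ P_ε` MAPS `𝒫 → 𝒫`, IS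
THE KOOPMAN GENERATOR ON POLYNOMIAL CLASSES, AND THE LOCAL CLASSES ARE A CORE — the typed form of the
"essential skew-adjointness of `𝓛_ε` on `𝒟`" asked for by triage r1-2 (iv) / r1-3; size M–L).**
(i) Algebra (any chain parameters): the Liouville operator of `pinnedChain` maps local polynomials to local
polynomials (every `u ∈ 𝒫 = Algebra.adjoin ℝ {coordinates}` is `MvPolynomial.aeval` of finitely many
coordinates, `Algebra.adjoin_range_eq_range_aeval`; `∂_{q_x}, ∂_{p_x}` of it is such a polynomial and
vanishes off its support; the forces are polynomial; the `tsum` over sites is a finite sum). (ii) For every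
datum as delivered by F: for `u ∈ 𝒫`, `t ↦ U_t [u] = [u ∘ φ_t]` is differentiable at `0` in `ℋ₀(Z.μ)` with
derivative `[𝓛_ε u]` — on polynomial classes Doyon's generator (`FluctuationDynamics.generator`, the strong
derivative at `0`; Stone's generator under strong continuity) IS the class map of `liouvilleZ`. (iii) The
classes of the local observables (`= span 𝒫 ∘ φ_s`, all in the generator's domain by (ii) and
`U_s`-covariance) form a CORE (`LinearPMap.HasCore`): the Koopman group of the datum is the unique
strongly continuous orthogonal group whose generator extends `[u ∘ φ_s] ↦ U_s[𝓛_ε u]`.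
Why true: (ii) along every orbit in `bmGood` (a `C¹` solution), `u(φ_tσ) − u(σ) = ∫₀ᵗ (𝓛u)(φ_sσ) ds`
(chain rule; `u` reads finitely many sites; F's normal form makes this an identity off a null set too),
hence `[u∘φ_t] − [u] − t[𝓛u] = ∫₀ᵗ (U_s[𝓛u] − [𝓛u]) ds` as an `ℋ₀`-valued Bochner integral (the class map is
`L²`-to-`ℋ₀` bounded on observables of a fixed range only up to clustering — use `form_eq_tsum` and the
uniform-in-`s ∈ [0,1]` clustering majorant of F's construction to exchange `Σ_x Cov` with `∫ ds`), whose
norm is `≤ ∫₀ᵗ ‖U_s[𝓛u] − [𝓛u]‖₀ ds = o(t)` by strong continuity (F). (iii) Engel–Nagel's core lemma: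
a dense subspace of the domain invariant under the group is a core — `span{[w] : w ∈ localObs}` is dense by
construction of `ℋ₀` (`FluctuationStructure.denseRange_toFluct`), invariant (`koopman_fluct`,
`comp_flow_mem`), and inside the domain by (ii) transported with `U_s`.
NOT claimed (and not needed by E): that the TIME-ZERO polynomial classes `span{[u] : u ∈ 𝒫}` alone are a
core — the literal reading of the triage request. That is a Marchioro–Pellegrinotti–Pulvirenti-type
essential skew-adjointness statement (CMP 58 (1978)) transplanted to `ℋ₀`; quasi-analytic-vector counting
FAILS for it (`‖𝓛_εⁿu‖₀` grows like `(n!)^{3/2+}` because `𝓛₁` raises the degree), so it would need the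
graph-norm density of `𝒫` in the local `C¹` class plus an MPP argument — plausible, XL, and idle here.
Why it might fail: (ii) needs the exchange of the class map with the time integral (a uniform clustering
majorant on `[0, t]`, which F's light-cone construction provides but F's STATEMENT does not export — the
prover of C re-derives it for the canonical datum, unique by `D.unique` on `bmGood` and DLR uniqueness); (i)
and (iii) cannot fail.
Role: lets E exponentiate the pencil (`U^ε_t` is determined by `𝓛_ε` on local classes, for every `ε`, on
ONE algebra `𝒫`), and turns S into `G_ε`-skewness of the GENERATOR on `𝒫` (`inner_generator_left` is then
literally the card's skewness), whence the exact `ε²`-Feshbach/Mori form of the memory function.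
Leans on: `liouvilleZ`, `partialQZ/partialPZ`, `ZeroWavenumberData.koopman/fluct/generator`,
`FluctuationDynamics.generatorDomain/hasDerivAt_koopman/inner_generator_left/koopman_fluct`,
`FluctuationStructure.denseRange_toFluct`, Mathlib `LinearPMap.HasCore/closure/IsClosable`,
`Algebra.adjoin_induction`, `MvPolynomial.aeval`. [cite: Doyon2022, §4.2 eqs. (4.9)–(4.10), Thm 4.11]
[cite: EngelNagel2000, Prop. II.1.7 (core lemma)] [cite: MarchioroPellegrinottiPulvirenti1978, Thm 1 (doi:10.1007/BF01609415)] -/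
def Sig.stub_pencilDerivation : Prop :=
    (∀ ω₂ lam β γ : ℝ, ∀ u ∈ Algebra.adjoin ℝ (Set.range fun xc : ℤ × Bool => fun σ : ChainConfig => if xc.2 then (σ xc.1).2 else (σ xc.1).1),
        liouvilleZ (pinnedChain ω₂ lam β γ) u ∈ Algebra.adjoin ℝ (Set.range fun xc : ℤ × Bool => fun σ : ChainConfig => if xc.2 then (σ xc.1).2 else (σ xc.1).1)) ∧
      ∀ ω₂ lam β : ℝ, 0 < ω₂ → 0 ≤ lam → 0 ≤ β →
        ∀ (D : InfiniteChainDynamics (pinnedChain ω₂ lam β 1)) (Z : ZeroWavenumberData (pinnedChain ω₂ lam β 1) D),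
          (pinnedChain ω₂ lam β 1).IsChainGibbsMeasure 1 Z.μ →
          D.carrier = (pinnedChain ω₂ lam β 1).bmGood →
          (∀ (t : ℝ) (σ : ChainConfig), σ ∉ (pinnedChain ω₂ lam β 1).bmGood → D.flow t σ = σ) →
          Z.toFluctuationDynamics.IsStronglyContinuous →
          Z.localObs = Submodule.span ℝ {w : ChainConfig → ℝ | ∃ u ∈ Algebra.adjoin ℝ (Set.range fun xc : ℤ × Bool => fun σ : ChainConfig => if xc.2 then (σ xc.1).2 else (σ xc.1).1), ∃ s : ℝ, w = u ∘ D.flow s} →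
          (∀ u ∈ Algebra.adjoin ℝ (Set.range fun xc : ℤ × Bool => fun σ : ChainConfig => if xc.2 then (σ xc.1).2 else (σ xc.1).1),
            HasDerivAt (fun t : ℝ => (Z.koopman t (Z.fluct u) : ZeroWavenumberSpace Z))
              (Z.fluct (liouvilleZ (pinnedChain ω₂ lam β 1) u)) 0) ∧
          Z.generator.HasCore
            (Submodule.span ℝ {ψ : ZeroWavenumberSpace Z | ∃ w ∈ Z.localObs, ψ = Z.fluct w})

/-- **Stub G — `stub_gramContinuity` (THE PENCIL'S METRIC: UNIFORM CLUSTERING AND CONTINUITY IN THE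
COUPLING OF THE GRAM FORM `G_ε` ON LOCAL POLYNOMIALS ALONG THE RAY, `ε ∈ [0, 1]`, HARMONIC ENDPOINT
INCLUDED; the card's First lemma `CurrentSusceptibilityContinuous` is the instance `u = v = j`; size M–L;
static, independent of `H` and of any dynamics).**
For `ω₂ > 0`, `a, b ≥ 0` and any family `ε ↦ μ ε` of shift-invariant DLR states at `T = 1` of
`pinnedChain ω₂ (aε) (bε) 1`, `ε ∈ [0,1]` (there is exactly one such state per `ε`:
`eq_of_isChainGibbsMeasure_of_isShiftInvariant_pinnedChain`, existence `exists_gibbsFamily_pinnedChain`; so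
this is a statement about THE thermal states of the ray), and all local polynomials `u, v`:
(i) `u ∈ L²(μ_ε)` with a bound uniform in `ε`; (ii) `x ↦ Cov_{μ_ε}(u, v ∘ τ_x)` is absolutely summable with
`Σ_x |Cov| ≤ C(u,v)` UNIFORMLY in `ε ∈ [0,1]`; (iii) `ε ↦ G_ε(u,v) = Σ_x Cov_{μ_ε}(u, v ∘ τ_x)` is continuous on
`[0, 1]` — in particular `G_ε → G₀` (the Gaussian form of the harmonic chain) entrywise on `𝒫 × 𝒫` as `ε ↓ 0`.
Why true: at `T = 1` momenta are i.i.d. `N(0,1)` independent of positions under every DLR state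
(`IsChainGibbsMeasure.indepFun_snd_fst`, `map_snd`), so everything reduces to the position marginal, the
stationary Markov chain of the transfer operator `𝒯_ε` with kernel
`e^{−[U_ε(q)+U_ε(q′)]/2 − V_ε(q′−q)}`, `U_ε = ω₂q²/2 + aεq⁴/4`, `V_ε = r²/2 + bεr⁴/4`: (i) all site moments are
finite under (2.3) (`exists_integral_abs_pow_add_le_pinnedChain`) with constants continuous in `ε` (the
kernels are dominated by the Gaussian one, `e^{−εq⁴} ≤ 1`); (ii) exponential ρ-mixing with a rate bounded
below on `[0,1]` — the Jentzsch gap of `𝒯_ε` is continuous in `ε` because `ε ↦ 𝒯_ε` is Hilbert–Schmidt-norm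
continuous on `[0,1]` (dominated convergence on the kernel) — and the covariance bound
`abs_integral_mul_sub_le_of_dependsOn_halfLine` give `|Cov(u, v∘τ_x)| ≤ C‖u‖₄‖v‖₄ e^{−m|x|}` uniformly;
(iii) each `Cov_{μ_ε}(u, v ∘ τ_x)` is continuous in `ε` (finite-dimensional marginals of the Markov chain are
ratios of integrals of `e^{−(polynomial in ε and q)}` against Lebesgue measure with the Jentzsch
eigenfunction, all continuous in `ε` by dominated convergence / continuity of the isolated top eigenpair),
and the uniform summable majorant of (ii) exchanges limit and sum. (The card claims more — `C^∞` at `0⁺`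
with cumulant-sum derivatives, Gevrey-1, zero radius of convergence (Dyson) — not needed by E and not
claimed here; the first derivative is the card's falsifier (b).)
Why it might fail: it cannot for fixed `u, v` (finite-range observables of a 1-D chain with a massive,
log-concave, Gaussian-dominated transfer operator); a DEGREE-UNIFORM version would be false (constants grow
with the degree — the honest form of the route's "W unbounded in degree"), and none is claimed.
Role: `G_ε → G₀` on `𝒫` is the only property of the interacting Gibbs state the leading (kinetic) term of
E needs (`χ_ε = G_ε(j^ε, j^ε) → χ₀`, and the metric in which K's free kernel is compared with the
interacting memory function); the uniform constants control E's error terms.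
Leans on: `IsChainGibbsMeasure`, `IsShiftInvariant`, `chainShift`, `ProbabilityTheory.covariance`,
`exists_gibbsFamily_pinnedChain`, `eq_of_isChainGibbsMeasure_of_isShiftInvariant_pinnedChain`,
`HasSuperstabilityEstimate.exists_integral_abs_pow_add_le_pinnedChain`, `exists_regular_state_mixing`
(`GreenKuboContinuation.TemperatureBlindVitaliHurwitz`), `Literature.Analysis.OperatorTheory.exists_groundState_markov_gap`,
`InfiniteChainStaticCurrentVariance` (the `u = v = j` instance: `Σ_x∫j₀j_x = ¼∫(V′(r₀)+V′(r₁))²`, a range-one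
static expectation — triage r1-2's remark that the First lemma is smaller than M).
[cite: Georgii2011, Thm 10.25 and §11.1] [cite: HelfferSjostrand1994, §1 (doi:10.1007/BF02186817)]
[cite: BrascampLieb1976, Thm 4.1] [cite: Dyson1952, (doi:10.1103/PhysRev.85.631)] [cite: Doyon2022, §4.1 Def. 4.3] -/
def Sig.stub_gramContinuity : Prop :=
    ∀ ω₂ a b : ℝ, 0 < ω₂ → 0 ≤ a → 0 ≤ b → ∀ μ : ℝ → MeasureTheory.Measure ChainConfig,
      (∀ ε ∈ Set.Icc (0 : ℝ) 1, (pinnedChain ω₂ (a * ε) (b * ε) 1).IsChainGibbsMeasure 1 (μ ε) ∧ IsShiftInvariant (μ ε)) →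
      ∀ u ∈ Algebra.adjoin ℝ (Set.range fun xc : ℤ × Bool => fun σ : ChainConfig => if xc.2 then (σ xc.1).2 else (σ xc.1).1),
      ∀ v ∈ Algebra.adjoin ℝ (Set.range fun xc : ℤ × Bool => fun σ : ChainConfig => if xc.2 then (σ xc.1).2 else (σ xc.1).1),
        (∃ M : ℝ, ∀ ε ∈ Set.Icc (0 : ℝ) 1, MeasureTheory.MemLp u 2 (μ ε) ∧ ∫ σ, (u σ) ^ 2 ∂(μ ε) ≤ M) ∧
        (∃ C : ℝ, ∀ ε ∈ Set.Icc (0 : ℝ) 1,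
          Summable (fun x : ℤ => |ProbabilityTheory.covariance u (v ∘ chainShift x) (μ ε)|) ∧
          ∑' x : ℤ, |ProbabilityTheory.covariance u (v ∘ chainShift x) (μ ε)| ≤ C) ∧
        ContinuousOn (fun ε : ℝ => ∑' x : ℤ, ProbabilityTheory.covariance u (v ∘ chainShift x) (μ ε))
          (Set.Icc (0 : ℝ) 1)

/-- **Stub S — `stub_polynomialStationarity` (GENERATOR-SENSE STATIONARITY OF THE THERMAL STATES ON
LOCAL POLYNOMIALS — the source of `G_ε`-SKEWNESS of `𝓛_ε` on `𝒫` and of the exact `ε²` Feshbach form;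
size M; every chain `ω₂ > 0`, `lam, β ≥ 0`, any `γ`, every `T > 0`).**
For every shift-invariant DLR Gibbs state `μ` of `pinnedChain ω₂ lam β γ` at `T` and every local polynomial
`f`: `𝒜f = liouvilleZ P f ∈ L¹(μ)` and `∫ 𝒜f dμ = 0`. This extends the tree's
`isTimeInvariant_pinnedChain_of_isShiftInvariant` (Bernardin's footnote class `C₀¹`: BOUNDED local `C¹`
functions with bounded derivative, `IsLocalTestFunction`) to the unbounded class `𝒫`.
Why true: the tree proof (`IsChainGibbsMeasure.integral_liouvilleZ_eq_zero`: FTC along the severed flow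
`T^Λ_s` of a box containing the support of `f`, `f(T^Λ_1σ) − f(σ) = ∫₀¹(𝒜f)(T^Λ_sσ)ds`, Fubini, and
`T^Λ_s`-invariance of `μ`, LLL 1977 §4 (i)) uses boundedness of `f` only to have `f ∘ T^Λ_1 − f` and
`(𝒜f) ∘ T^Λ_s` integrable; for polynomial `f` both follow from the finiteness of ALL site moments under the
superstability estimate (automatic for shift-invariant DLR states of `pinnedChain`,
`hasSuperstabilityEstimate_of_isShiftInvariant_pinnedChain`, `exists_integral_abs_pow_add_le_pinnedChain`)
and the invariance of `μ` under `T^Λ_s` (`measurePreserving_severedFlow_of_isChainGibbsMeasure`), which makes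
`∫|𝒜f|∘T^Λ_s dμ = ∫|𝒜f|dμ` constant in `s`. Alternatively: one-site Schwinger–Dyson identities
(`InfiniteChainGibbsBondForceByParts`, `integral_chainSpecification_singleton_position`) summed over the box.
Why it might fail: it cannot (finite moments of every order + the severed-flow invariance are in the tree);
the only debt is bookkeeping `𝒜f` for `f ∈ Algebra.adjoin` (structural induction on `adjoin`).
Role: with C(i) (`𝒫` is `𝓛`-stable) and Leibniz, `Cov(𝓛u, v∘τ_x) + Cov(u, (𝓛v)∘τ_x) = ∫𝓛(u·v∘τ_x)dμ − … = 0`,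
i.e. `G_ε(𝓛_εu, v) = −G_ε(u, 𝓛_εv)` on `𝒫`: the three order-by-order skewness identities of the card and
`P𝓛_εP = 0` on the odd charges (with `Θ`) follow, hence the memory/level-shift form is EXACTLY
`−ε²G_ε(Φ_ε, Q̄(z − Q̄𝓛_εQ̄)⁻¹Q̄Φ_ε)` with `Φ_ε = Φ + εb𝓛₁j⁽⁴⁾ ∈ 𝒫` (no `G₁`, `G₂` at order `ε²`; triage
r1-1 §E2 checked this by hand).
Leans on: `liouvilleZ`, `IsTimeInvariant` (pattern), `IsChainGibbsMeasure.integral_liouvilleZ_eq_zero`,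
`isTimeInvariant_pinnedChain_of_isShiftInvariant`, `integrable_force_pinnedChain`,
`measurePreserving_severedFlow_of_isChainGibbsMeasure`, `exists_integral_abs_pow_add_le_pinnedChain`.
[cite: Bernardin2014, §1.1 Def. 1 footnote] [cite: LanfordLebowitzLieb1977, §4 remark (i)] [folklore] -/
def Sig.stub_polynomialStationarity : Prop :=
    ∀ ω₂ lam β γ T : ℝ, 0 < ω₂ → 0 ≤ lam → 0 ≤ β → 0 < T →
      ∀ μ : MeasureTheory.Measure ChainConfig,
        (pinnedChain ω₂ lam β γ).IsChainGibbsMeasure T μ → IsShiftInvariant μ →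
        ∀ f ∈ Algebra.adjoin ℝ (Set.range fun xc : ℤ × Bool => fun σ : ChainConfig => if xc.2 then (σ xc.1).2 else (σ xc.1).1),
          MeasureTheory.Integrable (liouvilleZ (pinnedChain ω₂ lam β γ) f) μ ∧
          ∫ σ, liouvilleZ (pinnedChain ω₂ lam β γ) f σ ∂μ = 0

/-- **Stub K — `stub_freeForceKernel` (THE GAUSSIAN ENDPOINT: THE FREE FERMI-GOLDEN-RULE KERNEL OF THE
CURRENT — ABELIAN SPECTRAL FUNCTION OF THE FIRST-ORDER FORCE `Φ` UNDER THE HARMONIC THERMAL DYNAMICS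
EXISTS NEAR FREQUENCY `0`, IS CONTINUOUS THROUGH THE PAIR THRESHOLD AND IS POSITIVE AT `0`; the
dictionary line "FGR operator = `boltzmannForm`" of the route, hosted by the pencil (card item (2)) and asked
for by the 12594 lead ("the Feshbach identification … what any proof of S5 or S7 starts from");
LOAD-BEARING; size L–XL; true real analysis + Wick algebra).**
Data: `ω₂, a, b > 0` with the odd-sector gap `H : HasOddSectorGap ω₂ a b` (PROVED, `FGRGap_proof`); ANY
zero-wavenumber datum `(D₀, Z₀)` of the HARMONIC chain `pinnedChain ω₂ 0 0 1` at `T = 1` with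
`D₀.carrier = bmGood` (so the flow is the harmonic flow on the good set, canonical by `D₀.unique`, and
`Z₀.μ` is THE Gaussian shift-invariant DLR state), strongly continuous, whose observable space contains the
FIRST-ORDER FORCE ON THE CURRENT
`Φ := d/dε|₀ 𝓛_ε j^ε₀ = (𝓛_{(a,b)} − 𝓛_{(0,0)}) j⁽²⁾₀ + b·𝓛_{(0,0)}(j⁽⁴⁾₀)`,
written with tree functions only: `𝓛_{(a,b)} = liouvilleZ (pinnedChain ω₂ a b 1)`,
`j⁽²⁾₀ = bondCurrentZ (pinnedChain ω₂ 0 0 1) · 0 = −½(p₀+p₁)r₀`, `j⁽⁴⁾₀ = (bondCurrentZ (pinnedChain ω₂ 0 1 1)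
− bondCurrentZ (pinnedChain ω₂ 0 0 1)) · 0 = −½(p₀+p₁)r₀³` (`𝓛_ε j^ε = (k₀−k₁) + εΦ + ε²b𝓛₁j⁽⁴⁾` exactly, the
forces and the current being affine in `ε`, §4). Explicitly `Φ = (3b/2)(p₀²−p₁²)r₀² + (a/2)r₀(q₀³+q₁³)
− (b/2)r₀(r₁³−r₋₁³) + (bω₂/2)r₀³(q₀+q₁) − (b/2)r₀³(r₁−r₋₁)`, `r_x = q_{x+1} − q_x` (informal; the statement
uses the intrinsic form). Conclusion: the Abel–cosine transforms of the FREE FORCE KERNEL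
`K₀(t) = Z₀.form Φ (Φ ∘ φ⁰_t) = Σ_x Cov_{μ₀}(Φ₀, Φ_x ∘ φ⁰_t) = ⟪[Φ], U⁰_t[Φ]⟫₀`,
`A_ν(ω) = ∫₀^∞ e^{−νt}cos(ωt)K₀(t)dt`, converge as `ν ↓ 0` LOCALLY UNIFORMLY on a window `(−δ, δ)` to `πρ`,
`ρ` continuous on the window, `ρ(0) > 0`.
Why true (and what `ρ` is): `μ₀` is Gaussian and `φ⁰` linear, so by Wick's theorem with the harmonic
two-point function `K₀(t) = ∫cos(tx) dm_Φ(x)`, `m_Φ` = the spectral measure of the degree-4 polynomial class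
`[Φ]` for the free Liouvillian = a finite sum over the chaos channels of `[Φ]`: chaos 2, sectors `(2,0)/(0,2)`
(frequencies `±2ω(k)`, `|x| ≥ 2√ω₂`); chaos 4, sectors `(4,0)/(0,4)` (`|x| ≥ 4√ω₂`), `(3,1)/(1,3)`
(`|x| = ω₁+ω₂+ω₃−ω(k₁+k₂+k₃) ≥ √(9ω₂+s²) − √(ω₂+s²) > 0` by Minkowski and `|sin((Σkᵢ)/2)| ≤ Σ|sin(kᵢ/2)|` —
NON-RESONANT FOR EVERY `ω₂ > 0`), and the pair sector `(2,2)` with `x = Ω = resonanceFn ω₂` — the only channel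
reaching `0`. Two exact cancellations make the threshold harmless: (α) NO ATOM AT `0`: the `(1,1)` (conserved
one-phonon-charge) component of `[Φ]` vanishes — for `b𝓛₀j⁽⁴⁾ ∈ ran 𝓛₀` by skewness, and for
`𝓛₁j⁽²⁾ = {Q_{f_J}, H₄}` because every contraction of `{Q_f, H₄}` into the `(1,1)` sector pairs an `a*` with
an `a`, forcing equal momenta and killing the collision bracket `[f] = f₁+f₂−f₃−f₄` (gauge-invariant Gaussian:
`⟨aa⟩ = 0` by equipartition); equivalently the card's order-1 skewness identity with `𝓛₀Q_g = 0`;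
(β) CONTINUOUS WEIGHTED DENSITY OF STATES AT `Ω = 0`: the `(2,2)` amplitude of `[Φ]` is
`[f_J]·Φ_vertex + Ω·(smooth)`, vanishing on the exchange diagonal where the level-0 critical set of `Ω` lies
(`MourreDissolution.stub_pairThreshold`, LANDED) — exactly the weight of line swap-odd's stub B
(`Sig.stub_freeLevelShift` of 12594 = B0 `stub_levelShiftPushforward` LANDED ∧ B1 `stub_thresholdDensity`
(registered there, XL, true) ∧ B2 `stub_poissonLocallyUniform` LANDED) plus `O(Ω)` corrections whose
level-set densities are `O(E)`, `O(E² log(1/E))`. Hence `m_Φ` has a continuous density `ρ` on `(−δ, δ)`,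
`δ < min(2√ω₂, gap₃₁)`, and `πρ(0) = Σ_{(2,2)} ∫δ(Ω)|[f_J]Φ_v|² = c_{T=1}·(4π/alsPrefactor)·q_{ω₂,a,b}(f_J)`,
`q = boltzmannForm`, `f_J` the (odd) one-phonon profile of the harmonic current `∝ ω ω′ = sin k` up to the
thermal weight — POSITIVE by `H` (`q ≥ g₀‖·‖²` on odd profiles) [the exact constant `c_{T=1}` is the
dictionary's checkable number; it is deliberately not asserted — a refuter computes both sides, cf. the
line card's Cheapest falsifier]. Local uniformity: `stub_poissonLocallyUniform`.
Why it might fail: an algebraic slip in `Φ` cannot make it false unless it created a `(1,1)` component with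
EVEN profile (a harmonic charge overlapping the force ⇒ atom of `m_Φ` at `0` ⇒ `A_ν(0) → ∞`): excluded by
(α) for the intrinsic `Φ` as typed; a thermal bound/antibound pair state at the van Hove edge does not exist
for the FREE flow; the `(3,1)` gap is uniform in `ω₂ > 0` (above). Genuinely at risk only: the formal SIZE.
Role: `Γ₀ := πρ(0) > 0` is the kinetic decay rate of the current's memory function at leading order; E turns
"memory function `= ε²K₀ + o(ε²)` on the kinetic scale, up to the boundary" into the LAP with
`g(0) = χ₀²/(πε²Γ₀)(1+o(1))`, `χ₀ = G₀(j⁽²⁾,j⁽²⁾)` — the route's predicted `(T²/π)⟨ωω′,(λ²q)⁻¹ωω′⟩` in Mori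
(one-dimensional projection) form; the full Feshbach matrix on the odd charges refines the VALUE, not the
existence/positivity/continuity that the crux needs.
Leans on: `liouvilleZ`, `OscillatorChain.bondCurrentZ`, `pinnedChain`, `ZeroWavenumberData.form`
(`form_eq_tsum`, `form_comp_flow`, `inner_fluct_koopman_fluct`), `PhononBoltzmann.HasOddSectorGap`,
`boltzmannForm`, `resonanceFn`, `vertex`, `dispersion`, `PinnedChainResonantFinite.resonantSet_finite`,
`MourreDissolution.stub_pairThreshold/stub_levelShiftPushforward/stub_poissonLocallyUniform` (LANDED),
`HarmonicChaosDecomposition` (vocabulary: `Shell`, `chaosKoopman`, `currentProfile`), `AnharmonicPairBlock`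
(the `c = 1` vertex block), `InfiniteChainGibbsMomentaIndependence` (Wick inputs at `T = 1`).
[cite: AokiLukkarinenSpohn2006, §3 eqs. (3.15)–(3.20), (4.1), (4.10)–(4.11), (4.16)]
[cite: Lukkarinen2016, §2.1–2.2 and §3.4] [cite: vanHemmen1980, §§3–4 (doi:10.1016/0370-1573(80)90095-2)]
[cite: JaksicPillet1996, §1 (level shift operator)] [cite: Spohn2006, §4 (collisional invariants)] -/
def Sig.stub_freeForceKernel : Prop :=
    ∀ ω₂ a b : ℝ, 0 < ω₂ → 0 < a → 0 < b → HasOddSectorGap ω₂ a b →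
      ∀ (D₀ : InfiniteChainDynamics (pinnedChain ω₂ 0 0 1)) (Z₀ : ZeroWavenumberData (pinnedChain ω₂ 0 0 1) D₀),
        (pinnedChain ω₂ 0 0 1).IsChainGibbsMeasure 1 Z₀.μ →
        D₀.carrier = (pinnedChain ω₂ 0 0 1).bmGood →
        Z₀.toFluctuationDynamics.IsStronglyContinuous →
        (fun σ : ChainConfig => liouvilleZ (pinnedChain ω₂ a b 1) (fun σ => (pinnedChain ω₂ 0 0 1).bondCurrentZ σ 0) σ - liouvilleZ (pinnedChain ω₂ 0 0 1) (fun σ => (pinnedChain ω₂ 0 0 1).bondCurrentZ σ 0) σ + b * (liouvilleZ (pinnedChain ω₂ 0 0 1) (fun σ => (pinnedChain ω₂ 0 1 1).bondCurrentZ σ 0) σ - liouvilleZ (pinnedChain ω₂ 0 0 1) (fun σ => (pinnedChain ω₂ 0 0 1).bondCurrentZ σ 0) σ)) ∈ Z₀.localObs →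
        ∃ δ : ℝ, 0 < δ ∧ ∃ ρ : ℝ → ℝ, ContinuousOn ρ (Set.Ioo (-δ) δ) ∧ 0 < ρ 0 ∧
          TendstoLocallyUniformlyOn
            (fun (ν : ℝ) (ω : ℝ) => ∫ t in Set.Ioi (0 : ℝ), Real.exp (-(ν * t)) * (Real.cos (ω * t) *
              Z₀.form
                (fun σ : ChainConfig => liouvilleZ (pinnedChain ω₂ a b 1) (fun σ => (pinnedChain ω₂ 0 0 1).bondCurrentZ σ 0) σ - liouvilleZ (pinnedChain ω₂ 0 0 1) (fun σ => (pinnedChain ω₂ 0 0 1).bondCurrentZ σ 0) σ + b * (liouvilleZ (pinnedChain ω₂ 0 0 1) (fun σ => (pinnedChain ω₂ 0 1 1).bondCurrentZ σ 0) σ - liouvilleZ (pinnedChain ω₂ 0 0 1) (fun σ => (pinnedChain ω₂ 0 0 1).bondCurrentZ σ 0) σ))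
                ((fun σ : ChainConfig => liouvilleZ (pinnedChain ω₂ a b 1) (fun σ => (pinnedChain ω₂ 0 0 1).bondCurrentZ σ 0) σ - liouvilleZ (pinnedChain ω₂ 0 0 1) (fun σ => (pinnedChain ω₂ 0 0 1).bondCurrentZ σ 0) σ + b * (liouvilleZ (pinnedChain ω₂ 0 0 1) (fun σ => (pinnedChain ω₂ 0 1 1).bondCurrentZ σ 0) σ - liouvilleZ (pinnedChain ω₂ 0 0 1) (fun σ => (pinnedChain ω₂ 0 0 1).bondCurrentZ σ 0) σ)) ∘ D₀.flow t)))
            (fun ω => Real.pi * ρ ω) (𝓝[>] (0 : ℝ)) (Set.Ioo (-δ) δ)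

/-- **Stub E — `stub_pencilDissolution` (THE ENGINE: DISSOLUTION OF THE DRUDE ATOM ALONG THE RAY FROM
THE PENCIL — LIMITING ABSORPTION AT FREQUENCY `0` FOR THE CURRENT OF `pinnedChain ω₂ (aε) (bε) 1` AT
`T = 1`, ALL SMALL `ε > 0`, ABELIAN/POISSON FORM; HARDEST; open-problem class; statement
`F → C → G → S → K → LAP`).**
Assume stubs F, C, G, S, K (as hypotheses, by name). For `ω₂, a, b > 0` with `HasOddSectorGap ω₂ a b`
there is `ε₀ > 0` such that for every `ε ∈ (0, ε₀)` and EVERY datum `(D, Z)` of `pinnedChain ω₂ (aε) (bε) 1`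
with the clauses F delivers (DLR at `1`, BM carrier in normal form, everywhere translation/reflection
covariance, `ι`-invariant state, momentum reversal, strong continuity, `localObs = span 𝒫 ∘ φ_s`), the
Poisson transforms `A_ν(ω) = ∫₀^∞ e^{−νt}cos(ωt) C_ε(t) dt` of `C_ε = D.currentCorrelation Z.μ`
(`= ⟪[J], U_t[J]⟫₀`) converge as `ν ↓ 0` LOCALLY UNIFORMLY on a window `(−δ, δ)` to `πg`, `g` continuous on
the window, `g(0) > 0` (`δ` may and will depend on `ε`: `δ ≍ ε²`).
Intended proof (the card's lever, with the triage's sharpenings): Mori/Feshbach in `ℋ₀(μ_ε)` on the core `𝒫`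
(C): with `χ_ε = G_ε(j^ε, j^ε)` (`→ χ₀ > 0`, G + `InfiniteChainStaticCurrentVariance`) and the memory
function `M̂_ε(z) := χ_ε²/Ĉ_ε(z) − zχ_ε` one has EXACTLY (S: skewness; `𝓛₀j⁽²⁾ ~ 0`)
`M̂_ε(z) = ε² G_ε(Φ_ε, (z − Q̄_ε𝓛_εQ̄_ε)⁻¹ Φ_ε)`, `Φ_ε = Φ + εb𝓛₁j⁽⁴⁾ ∈ 𝒫` FIXED polynomials,
`Q̄_ε = 1 − |j^ε⟩⟨j^ε|/χ_ε`. Three steps: (E1) FIXED `z` (`Re z > 0` independent of `ε`):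
`ε⁻²M̂_ε(z) → G₀(Φ, (z − 𝓛₀)⁻¹Φ)` — Trotter–Kato/Kurtz strong resolvent convergence for generators
`𝓛₀ + ε𝓛₁` on the common core `𝒫` in the varying Hilbert spaces `(𝒫, G_ε)` (G: `G_ε → G₀`; C: core;
S: dissipativity) — PROVABLE, size L; (E2) KINETIC SCALE `z = ε²ζ`, `Re ζ > 0` fixed:
`ε⁻²M̂_ε(ε²ζ) → K̂₀(0⁺) = Γ₀ − iΣ₀` (Davies' weak-coupling limit: `P𝓛₁P = 0` by `Θ`, `∫₀^∞|K₀| < ∞` —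
the free kernel decays like `t⁻³ log t`, line swap-odd's toy (B), kit j011013 — and the Dyson/Duhamel
expansion of `e^{tQ̄𝓛_εQ̄}` against `U⁰_t` organised on `𝒫` with G's degree-graded constants; this is route
KineticCorner's `KineticLimit` (stmt-3431) in pencil form, the frontier of Lukkarinen–Spohn 2011 — HARD but
of known type); (E3) BOUNDARY: the convergence in (E2) holds UNIFORMLY for `ζ` in a closed half-disc
`{Re ζ ≥ 0, |ζ| ≤ r}` with a continuous limit `Λ₀(ζ)`, `Re Λ₀ ≥ Γ₀/2 > 0` (K gives `Re K̂₀` continuous and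
positive near `0` at the free level) — "beyond every kinetic time", the research-open core (the card's real
wall, triage r1-1: "the reduced resolvent at `|Im z| ≲ ε²` is not an `O(ε)` perturbation of the free one";
candidate tools: a weakly-conjugate Mourre estimate for `Q̄𝓛_εQ̄` in the `|∇_{shell}Ω|` scale with the
conjugate operator of `SecondQuantisedConjugateOperator` dressed on the pencil, positivity from `H` on the odd
charges and from K off them). Given (E3): `Ĉ_ε(ν − iω) = χ_ε²/((ν − iω)χ_ε + M̂_ε(ν − iω))` converges locally
uniformly on `|ω| < rε²/2` to a continuous boundary value with `πg(ω) = Re Ĉ_ε(0⁺ − iω)`,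
`g(0) = χ_ε²/(π Re M̂_ε(0)) · (Re M̂/|M̂|²·Re M̂)… = χ₀²/(πε²Γ₀)(1 + o(1)) > 0`.
Why it might fail: (E3) — inter-channel `O(ε)` couplings with no free gap to absorb them (`|∇Ω|²` is
gapless on the zero-momentum pair shell; BFS/Merkli have `N ≥ 1`), thermal (anti)bound co-moving pairs at
the van Hove edge visible to the force `Φ_ε`, or a Drude atom / `|ω|^{−α}` cusp of `σ_J` coexisting with the
kinetic gap (route kill criterion (c)); (E2) fails only if the kinetic picture itself fails for the pinned
chain (ALS06 §3's "tentative" 1-D caveat).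
Honest status: E IMPLIES the crux for the canonical data (with the landed window lemma) and is implied by it
up to the LAP dress (`stub_poissonLocallyUniform`); what the pencil buys is (E1) for free, a Davies-shaped
(E2), and a precisely located (E3) — not a smaller (E3). Foreseen reshape (≤ 7 stubs in all): E ⇐ E1
(Trotter–Kato on the pencil, provable) + E2 (kinetic-scale limit of the memory function) + E3 (boundary
uniformity), glued by the Mori algebra above (provable, `EmbeddedDrudeMourreMourreDissolutionLAP*` /
`LineReduction` tools: `re_laplace_coeff_eq`, `currentCorrelation_matrixCoefficient`).
Leans on: everything F delivers; `ZeroWavenumberData.inner_currentClass_koopman_eq_currentCorrelation'`,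
`currentCorrelation_neg`, `sum_mul_currentCorrelation_nonneg`; `MourreDissolution.LineReduction`
(`OneParameterUnitaryGroup`, Laplace coefficients), `…LAPDissipativeResolvent*`, `…FgrReduction`,
`SecondQuantisedConjugateOperator`, `HarmonicChaosDecomposition`, `PhononBoltzmann.HasOddSectorGap`,
`KineticConductivityFinite` (the predicted value), Disproof §2 (`atom_eq_zero_of_window`: E ⇒ no Drude atom,
consistent — E pays for it in (E3), never assumes it).
[cite: Davies1974, Thm 2.3 (weak coupling limit)] [cite: LukkarinenSpohn2011, Thm 2.4] [cite: JaksicPillet1996, Thms 1.1–1.2]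
[cite: BachFrohlichSigal2000, §I–II] [cite: Merkli2001] [cite: DerezinskiJaksic2003, (doi:10.1007/s00023-003-0146-4)]
[cite: BoutetdeMonvelMantoiu1997, Thm 1] [cite: AokiLukkarinenSpohn2006, §3 (3.18)–(3.26)] [cite: Doyon2022, §4–5]
[cite: Mori1965] [cite: Kurtz1969 (semigroup convergence on varying spaces)] -/
def Sig.stub_pencilDissolution : Prop :=
    Sig.stub_pencilFramework → Sig.stub_pencilDerivation → Sig.stub_gramContinuity →
      Sig.stub_polynomialStationarity → Sig.stub_freeForceKernel →
    ∀ ω₂ a b : ℝ, 0 < ω₂ → 0 < a → 0 < b → HasOddSectorGap ω₂ a b →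
      ∃ ε₀ : ℝ, 0 < ε₀ ∧ ∀ ε : ℝ, 0 < ε → ε < ε₀ →
        ∀ (D : InfiniteChainDynamics (pinnedChain ω₂ (a * ε) (b * ε) 1))
          (Z : ZeroWavenumberData (pinnedChain ω₂ (a * ε) (b * ε) 1) D),
            (pinnedChain ω₂ (a * ε) (b * ε) 1).IsChainGibbsMeasure 1 Z.μ →
            D.carrier = (pinnedChain ω₂ (a * ε) (b * ε) 1).bmGood →
            (∀ t : ℝ, Measurable (D.flow t)) →
            (∀ (t : ℝ) (σ : ChainConfig), σ ∉ (pinnedChain ω₂ (a * ε) (b * ε) 1).bmGood → D.flow t σ = σ) →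
            (∀ (t : ℝ) (x : ℤ), D.flow t ∘ chainShift x = chainShift x ∘ D.flow t) →
            (∀ t : ℝ, (fun (σ : ChainConfig) (i : ℤ) => σ (-i)) ∘ D.flow t = D.flow t ∘ (fun (σ : ChainConfig) (i : ℤ) => σ (-i))) →
            MeasureTheory.MeasurePreserving (fun (σ : ChainConfig) (i : ℤ) => σ (-i)) Z.μ Z.μ →
            Z.HasMomentumReversal →
            Z.toFluctuationDynamics.IsStronglyContinuous →
            Z.localObs = Submodule.span ℝ {w : ChainConfig → ℝ | ∃ u ∈ Algebra.adjoin ℝ (Set.range fun xc : ℤ × Bool => fun σ : ChainConfig => if xc.2 then (σ xc.1).2 else (σ xc.1).1), ∃ s : ℝ, w = u ∘ D.flow s} →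
            ∃ δ : ℝ, 0 < δ ∧ ∃ g : ℝ → ℝ, ContinuousOn g (Set.Ioo (-δ) δ) ∧ 0 < g 0 ∧
              TendstoLocallyUniformlyOn
                (fun (ν : ℝ) (ω : ℝ) => ∫ t in Set.Ioi (0 : ℝ),
                  Real.exp (-(ν * t)) * (Real.cos (ω * t) * D.currentCorrelation Z.μ t))
                (fun ω => Real.pi * g ω) (𝓝[>] (0 : ℝ)) (Set.Ioo (-δ) δ)

/-! ## §1b LEAD c11 RESHAPE of K: the six sub-stub STATEMENTS (K1, K2, KAlg, K6, KΦ, KT)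

Conventions: `T = 1`; `w_f = thermalWave ω₂ 1 f` (HarmonicChaos); momenta on `𝕋 = AddCircle (2π)` with its Haar probability
measure `μ𝕋` (`PinnedChainKinetic`); CREATION slots carry `conj`, annihilation slots do not; the zero-momentum shells are parametrised
by `κ = (k₁, k₂, k₃) ∈ 𝕋3` as in each formula; `cov[·,·;μ]` is Mathlib's covariance. -/

/-- **Stub K1 — `stub_harmonicStein` (LEAD c11 RESHAPE of K; GAUSSIAN CALCULUS OF THE HARMONIC THERMAL STATE WITHOUT
GAUSSIAN MEASURES; size L; TRUE).** For `ω₂ > 0`, `T > 0` and any shift-invariant DLR state `μ` of the HARMONIC chain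
`pinnedChain ω₂ 0 0 γ` at temperature `T` (there is exactly one: `OscillatorChain.eq_of_isChainGibbsMeasure_of_isShiftInvariant_pinnedChain`):
(i) every product of linear local observables `φ(f) = Σ_x (f^q_x q_x + f^p_x p_x)` (`HarmonicChaos.linObs`) is integrable; (ii) `E φ(f) = 0`;
(iii) STEIN'S RECURSION `E[φ(f₀) Πᵢ φ(fᵢ)] = Σᵢ C_T(f₀, fᵢ) E[Π_{j ≠ i} φ(f_j)]` with the thermal covariance
`C_T(f, g) = T(ΣΣ f^q_x g^q_y G(x − y) + Σ_x f^p_x g^p_x)`, `G = HarmonicChaos.greenFn ω₂` — i.e. all mixed moments are the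
Isserlis/Wick moments of the centred Gaussian with covariance `C_T` (which is all the line needs of "μ₀ is Gaussian").
Why true / route (no transfer operators, no characteristic functionals): moments of every order are finite and site-uniform
(`OscillatorChain.exists_integral_abs_pow_add_le_pinnedChain_of_isShiftInvariant`, Hölder for products); MOMENTA: one-site DLR
factorisation `IsChainGibbsMeasure.lintegral_snd_mul` (`∫ φ(p_i) G dμ = (∫ φ dN(0,T)) ∫ G dμ` for `G` not reading `p_i`) iterated over
the sites gives `E[Πᵢ hᵢ(p_{xᵢ}) g(q)] = Πᵢ N(hᵢ) E[g(q)]`, and Stein for one Gaussian `∫ p h(p) dN(0,T) = T ∫ h' dN` on polynomials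
(moments of `gaussianReal`, `ProbabilityTheory.centralMoment`/`mgf` API or `integral_sq_gaussianReal` pattern); POSITIONS: the landed
stub S (`…GramPencilHarmonicChaos.stub_polynomialStationarity`: `∫ 𝓛₀ f dμ = 0` on local polynomials) with `f = p_x · g(q)` gives the
Schwinger–Dyson identity `E[(Aq)_x g] = T E[∂_{q_x} g]`, `A = (ω₂ + 2) − S − S⁻¹` (the harmonic force is `−(Aq)_x`; momenta factor out),
and the Gaussian moment `W` of the same degree satisfies the same identity because `A G = δ₀`
(`(ω₂+2)G(x) − G(x+1) − G(x−1) = ∫ cos(kx) dμ𝕋 = [x = 0]`); the difference `d(x) = E[q_x g] − W(x, …)` is BOUNDED in `x`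
(Cauchy–Schwarz + shift invariance) and solves `A d = 0`, hence `d = 0` (no bounded lattice mode for `ω₂ > 0`: the argument of
`FlatProfileState` in `HarmonicHostFlatProfileState.lean`, `J ℓ = a^{|ℓ|} J 0`); induction on the degree. `γ` plays no role.
Consumed by: K2 (Wick covariances), K6. Leans on: `HarmonicChaos.{TestFn, linObs, thermalCov, greenFn}`, `IsChainGibbsMeasure`,
`IsShiftInvariant(.integral_comp_shift, .measurePreserving_chainShift)`, `stub_polynomialStationarity`, `liouvilleZ`,
`IsChainGibbsMeasure.lintegral_snd_mul/indepFun_snd_fst/map_snd`, `exists_integral_abs_pow_add_le_pinnedChain_of_isShiftInvariant`,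
Mathlib `gaussianReal`, `Fin.removeNth`, `Fin.prod_univ_succAbove`. [cite: Janson1997, Thm 1.28 (Wick/Isserlis) and Thm 3.9]
[cite: LanfordLebowitzLieb1977, §4 remark (ii)] -/
def Sig.stub_harmonicStein : Prop :=
  ∀ ω₂ γ T : ℝ, 0 < ω₂ → 0 < T → ∀ μ : MeasureTheory.Measure ChainConfig,
    (pinnedChain ω₂ 0 0 γ).IsChainGibbsMeasure T μ → IsShiftInvariant μ →
      (∀ (N : ℕ) (f : Fin N → TestFn), MeasureTheory.Integrable (fun σ : ChainConfig => ∏ i, linObs (f i) σ) μ) ∧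
      (∀ f₀ : TestFn, ∫ σ, linObs f₀ σ ∂μ = 0) ∧
      (∀ (N : ℕ) (f₀ : TestFn) (f : Fin (N + 1) → TestFn),
          ∫ σ, linObs f₀ σ * ∏ i, linObs (f i) σ ∂μ =
            ∑ i : Fin (N + 1), thermalCov ω₂ T f₀ (f i) * ∫ σ, ∏ j : Fin N, linObs (Fin.removeNth i f j) σ ∂μ)

/-- The CONCLUSION of stub K2 (lead c11, v5), named separately so that K6 can take it as a hypothesis BY NAME while the
composition discharges K2's own premise K1: the static zero-wavenumber form of Wick monomials of degrees 2 and 4 under the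
shift-invariant DLR state of the harmonic chain at `T = 1` is the real part of the chaos-space inner product of their Wick vectors. -/
def Sig.wickShellStaticConclusion : Prop :=
  ∀ ω₂ γ : ℝ, 0 < ω₂ → ∀ μ : MeasureTheory.Measure ChainConfig,
    (pinnedChain ω₂ 0 0 γ).IsChainGibbsMeasure 1 μ → IsShiftInvariant μ →
      ∀ (N M : ℕ) (f : Fin N → TestFn) (g : Fin M → TestFn), (N = 2 ∨ N = 4) → (M = 2 ∨ M = 4) →
        Summable (fun y : ℤ => cov[wick ω₂ 1 N f, wick ω₂ 1 M g ∘ chainShift y; μ]) ∧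
        ∑' y : ℤ, cov[wick ω₂ 1 N f, wick ω₂ 1 M g ∘ chainShift y; μ] = (⟪wickVector ω₂ 1 f, wickVector ω₂ 1 g⟫_ℂ).re

/-- [v5, chaos vocabulary: the conclusion is stated as `Σ'_y cov = Re ⟪wickVector ω₂ 1 f, wickVector ω₂ 1 g⟫_ℂ` in the tree's chaos space `HarmonicChaos.ChaosSpace = lp SectorFamily 2` — sector by sector `∫_{Shell m n} conj(wickKernel f m n)·wickKernel g m n d(shellMeasure)`, `wickKernel` carrying `(m!n!)^{-1/2}` and the Haar PROBABILITY measure of the zero-momentum shell; after parametrising `Shell 2 2`, `Shell 3 1`, `Shell 4 0` by `𝕋3` (continuous `AddEquiv` ⇒ measure preserving, `HarmonicChaos.measurePreserving_addEquiv`) this is exactly the explicit grouped formula `(1/24)T₄₀ + (1/6)T₃₁ + (1/4)T₂₂ + (1/6)T₁₃ + (1/24)T₀₄` described next (degree 2: `(1/2)T₂₀ + T₁₁ + (1/2)T₀₂`); restricted to degrees `N, M ∈ {2, 4}` (all the line needs); different degrees are orthogonal (disjoint sector supports).] **Stub K2 — `stub_wickShellStatic` (LEAD c11 RESHAPE of K;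 THE STATIC ZERO-WAVENUMBER FORM OF WICK MONOMIALS AS
ZERO-MOMENTUM SHELL INTEGRALS; held by the lead; size L; TRUE — checked to 12 digits against exact Gaussian lattice sums,
`work/scratch/check_shell.py`).** At `T = 1`, for the shift-invariant DLR state `μ` of `pinnedChain ω₂ 0 0 γ` (`ω₂ > 0`) and Wick
monomials `:φ(f₀)⋯φ(f₃):` (`HarmonicChaos.wick ω₂ 1 4 f`): the summed truncated correlation `Σ_y Cov(:Πφ(fᵢ):, :Πφ(gᵢ): ∘ τ_y)`
converges absolutely and equals `Re[(1/12)·T₄₀ + (1/3)·T₃₁ + (1/4)·T₂₂]`, where for the sector `(m,n)` (`m` created, `n`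
annihilated phonons) `T_{mn}(f,g) = ∫_{𝕋³} conj(S_{mn}f) · S_{mn}g dμ𝕋3`, `S_{mn}f(κ) = Σ_{π ∈ S₄} Π_slots w^{(*)}_{f_{π i}}` is the
SYMMETRISED product of thermal one-phonon waves `w_f = HarmonicChaos.thermalWave ω₂ 1 f` (`= √(1/2)(Σ f^q_x e^{ikx}/ω − iΣ f^p_x e^{ikx})`),
conjugated on creation slots, on the zero-momentum shell parametrised by `κ = (k₁,k₂,k₃) ∈ 𝕋3`: sector (4,0) creation momenta
`k₁,k₂,k₃,−k₁−k₂−k₃`; (3,1) creation `k₁,k₂,k₃`, annihilation `k₁+k₂+k₃`; (2,2) creation `k₁,k₂`, annihilation `k₃, k₄ = k₁+k₂−k₃`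
(`PinnedChainKinetic.k₄`). Degree 2: `Σ_y Cov(:φφ:, :φφ: ∘ τ_y) = Re[T₂₀ + T₁₁]` on `𝕋` ((2,0): creation `k, −k`; (1,1): creation `k`,
annihilation `k`). (The sixteen creation/annihilation patterns of the expansion `Π 2Re = Σ_ε` collapse to these by permutation symmetry of
the symmetrised kernels and complex conjugation of complementary patterns: multiplicities `1+1, 4+4, 6` over `4! = 24`, `1+1, 2` over `2`.)
Why true / route: Wick's theorem for Wick products `E[:Πφ(fᵢ): · :Πφ(gⱼ):] = δ_{NM} Σ_{π} Πᵢ C(fᵢ, g_{πi})` from K1's Stein recursion by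
induction along `HarmonicChaos.wick`'s recursion (Janson Thm 3.9); `:Πφ(gᵢ): ∘ τ_y = :Πφ(τ_y gᵢ):` (shift of coefficients,
`Finsupp.mapDomain (· + y)`; `C` is shift-invariant); the TWO-POINT FUNCTION AS A ONE-PHONON INTEGRAL
`C₁(f, τ_y g) = 2 Re ∫ conj(w_f) w_g e^{iky} dμ𝕋` (from `greenFn`'s definition, `fourier` characters); expand `Πᵢ 2Re zᵢ = Σ_ε Π zᵢ^{(ε)}`
with `conj(∫ A e^{iky}) = ∫ conj(A(−k)) e^{iky}`; the LATTICE PARSEVAL / MOMENTUM CONSERVATION identity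
`Σ_{y∈ℤ} Πᵢ₌₁⁴ fourierCoeff hᵢ y = ∫ h₁(k₁)h₂(k₂)h₃(k₃)h₄(−k₁−k₂−k₃) dμ𝕋3` (and the 2-factor version `Σ_y ĥ₁ĥ₂(y) = ∫ h₁(k)h₂(−k)`) for
continuous `hᵢ` — convolution theorem on `AddCircle (2π)` + the `fourierBasis` Parseval (`HilbertBasis.hasSum_inner_mul_inner`);
regroup the patterns using measure-preserving automorphisms of `𝕋3` (`HarmonicChaos.measurePreserving_addEquiv`).
Consumed by: K6 (initial values of the ODE argument and the norm bound). Leans on: K1 (hypothesis, by name), `HarmonicChaos.{wick,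
thermalWave, thermalCov, greenFn, linObs}`, `chainShift`, `PinnedChainKinetic.{𝕋, μ𝕋, 𝕋3, μ𝕋3, k₄, dispersion}`, Mathlib `fourierCoeff`,
`fourierBasis`, `ProbabilityTheory.covariance`. [cite: Janson1997, Thms 3.9 and 7.26] [folklore] -/
def Sig.stub_wickShellStatic : Prop :=
  Sig.stub_harmonicStein → Sig.wickShellStaticConclusion

/-- **Stub KAlg — `stub_harmonicPencilAlgebra` (LEAD c11 RESHAPE of K; THE PENCIL'S ALGEBRA AT THE HARMONIC POINT: `𝓛₀` IS A
DERIVATION ACTING ON WICK PRODUCTS SLOT BY SLOT THROUGH THE LATTICE KLEIN–GORDON GENERATOR `L`, WHICH IS MULTIPLICATION BY `−iω` ON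
THERMAL WAVES AND SKEW FOR THE THERMAL COVARIANCE; size M–L; pure algebra; TRUE).** With the linearised generator on coefficient data
`L f = (−(ω₂+2) f^p + f^p(· − 1) + f^p(· + 1), f^q)` (so that `𝓛₀ φ(f) = φ(L f)`: `𝓛₀ q_x = p_x`, `𝓛₀ p_x = −(ω₂+2)q_x + q_{x+1} + q_{x−1}`;
`Finsupp.mapDomain (· + 1) f^p` has value `f^p_{x−1}` at `x`): (a) Wick products of linear observables are local polynomials (members of
`Algebra.adjoin ℝ {coordinates}` — induction on the `wick` recursion); (b) LEIBNIZ: `𝓛₀ :φ(f₀)⋯φ(f_{N−1}): = Σᵢ :⋯φ(L fᵢ)⋯:` pointwise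
(`𝓛₀ = liouvilleZ (pinnedChain ω₂ 0 0 γ)` is a derivation on local polynomials vanishing on constants, `liouvilleZ_localPolynomial_apply` /
`liouvilleZ_add/mul` patterns of the landed S- and C-files, plus (d)); (c) `w_{Lf}(k) = −iω(k) w_f(k)`
(`Σ_x (Lf)^q_x e^{ikx} = −ω(k)² f̂^p(k)`, `ω² = ω₂ + 2 − 2cos k`); (d) `C_T(Lf, g) = −C_T(f, Lg)` — the Green identity
`(ω₂+2)G(x) − G(x+1) − G(x−1) = [x = 0]` for `G = greenFn ω₂` (`∫ cos(kx)(ω₂+2−2cos k)/ω² dμ𝕋 = ∫ cos(kx) dμ𝕋`) and symmetry of `A`.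
Consumed by: K6 ((b),(c): the matrix coefficients of `U_t` on Wick monomials solve a closed linear ODE), KΦ ((b),(c) for the
`b·𝓛₀j⁽⁴⁾` part of `Φ`, (a)), the composition ((a): `Φ ∈ 𝒫`). Leans on: `HarmonicChaos.{wick, linObs, thermalCov, thermalWave, greenFn}`,
`liouvilleZ`, `partialQZ/partialPZ`, `OscillatorChain.force`, `pinnedChain`, `PinnedChainKinetic.dispersion(_sq)`, Mathlib `Finsupp.sum_mapDomain_index`,
`fourier_add`, `Algebra.adjoin`. [cite: Janson1997, Thm 3.15 (Wick recursion)] [folklore] -/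
def Sig.stub_harmonicPencilAlgebra : Prop :=
  (∀ (ω₂ T : ℝ) (N : ℕ) (f : Fin N → TestFn), wick ω₂ T N f ∈ Algebra.adjoin ℝ (Set.range fun xc : ℤ × Bool => fun σ : ChainConfig => if xc.2 then (σ xc.1).2 else (σ xc.1).1)) ∧
  (∀ (ω₂ γ T : ℝ), 0 < ω₂ → ∀ (N : ℕ) (f : Fin N → TestFn) (σ : ChainConfig),
      liouvilleZ (pinnedChain ω₂ 0 0 γ) (wick ω₂ T N f) σ =
        ∑ i : Fin N, wick ω₂ T N (Function.update f i ((-(ω₂ + 2)) • (f i).2 + Finsupp.mapDomain (fun x : ℤ => x + 1) (f i).2 + Finsupp.mapDomain (fun x : ℤ => x - 1) (f i).2, (f i).1)) σ) ∧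
  (∀ (ω₂ T : ℝ), 0 < ω₂ → ∀ (f : TestFn) (k : 𝕋),
      thermalWave ω₂ T ((-(ω₂ + 2)) • f.2 + Finsupp.mapDomain (fun x : ℤ => x + 1) f.2 + Finsupp.mapDomain (fun x : ℤ => x - 1) f.2, f.1) k = -Complex.I * (PinnedChainKinetic.dispersion ω₂ k : ℂ) * thermalWave ω₂ T f k) ∧
  (∀ (ω₂ T : ℝ), 0 < ω₂ → ∀ f g : TestFn,
      thermalCov ω₂ T ((-(ω₂ + 2)) • f.2 + Finsupp.mapDomain (fun x : ℤ => x + 1) f.2 + Finsupp.mapDomain (fun x : ℤ => x - 1) f.2, f.1) g = -thermalCov ω₂ T f ((-(ω₂ + 2)) • g.2 + Finsupp.mapDomain (fun x : ℤ => x + 1) g.2 + Finsupp.mapDomain (fun x : ℤ => x - 1) g.2, g.1))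

/-- [v5, chaos vocabulary: hypotheses K2 (whose own K1 premise the composition discharges) and KAlg BY NAME; conclusion `Z.form P (P ∘ φ_t) = Re ⟪Ψ_P, chaosKoopman ω₂ t Ψ_P⟫_ℂ` with the chaos vector `Ψ_P = Σⱼ cⱼ • wickVector ω₂ 1 fⱼ + Σⱼ dⱼ • wickVector ω₂ 1 gⱼ` of the presentation — TRUE for every presentation (no vanishing hypotheses needed: degree 2 and degree 4 live on disjoint sectors); `chaosKoopman` multiplies the sector `(m,n)` by `exp(it·sectorPhase)`, `sectorPhase = Σ_created ω − Σ_annihilated ω` (`= PinnedChainKinetic.resonanceFn` on `Shell 2 2`). The ODE route below is unchanged: differentiate `t ↦ ⟪Ψ_u, chaosKoopman ω₂ t (wickVector v)⟫` sectorwise (multiplication by a bounded continuous phase on `L²` of a compact shell) and use KAlg (c) in the form `Σᵢ wickVector (v[i ← Lvᵢ]) = (i·sectorPhase) • wickVector v` sectorwise (`wickKernel` is a sum over slot assignments; a creation slot carries `conj(−iω w) = +iω conj w`).] **Stub K6 — `stub_wickShellDynamic` (LEAD c11 RESHAPE of K; THE HARMONIC SPECTRAL FORMULA FOR WICK POLYNOMIALS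 UNDER THE
THERMAL KOOPMAN GROUP, BY ODE UNIQUENESS IN `ℋ₀` — NO POINTWISE IDENTIFICATION OF THE BUTTÀ–MARCHIORO FLOW; size L; TRUE — the
monomial version checked numerically at `t = 0.7`, `work/scratch/check_shell_t.py`).** For the harmonic chain `pinnedChain ω₂ 0 0 1`
(`ω₂ > 0`) and ANY datum `(D, Z)` with the clauses the landed F delivers at `(lam, β) = (0, 0)` (DLR at `T = 1`, `carrier = bmGood`, flow
`= id` off `bmGood`, strongly continuous Koopman group, `localObs = span{u ∘ φ_s : u ∈ 𝒫}`), and any Wick polynomial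
`P = Σⱼ cⱼ :φ(f_{j0})⋯φ(f_{j3}): + Σⱼ dⱼ :φ(g_{j0})φ(g_{j1}): + c₀` WHOSE DEGREE-2 PART HAS VANISHING ZERO-MOMENTUM KERNELS (the three
hypotheses: sectors (2,0), (1,1), (0,2)), the autocorrelation in Doyon's form is the explicit trigonometric integral
`Z.form P (P ∘ φ_t) = (1/12)∫|S₄₀P|² cos(tΩ₄₀) + (1/3)∫|S₃₁P|² cos(tΩ₃₁) + (1/4)∫|S₂₂P|² cos(tΩ₂₂)` over `μ𝕋3`, with the symmetrised
sector kernels of K2 extended linearly (`S_{mn}P = Σⱼ cⱼ S_{mn}f_j`) and the free sector frequencies `Ω₄₀ = ω₁+ω₂+ω₃+ω(−Σk)`,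
`Ω₃₁ = ω₁+ω₂+ω₃−ω(Σk)`, `Ω₂₂ = ω₁+ω₂−ω₃−ω₄ = PinnedChainKinetic.resonanceFn ω₂` — i.e. the spectral measure of `[P]` is the
pushforward of `|S_{mn}P|² dμ𝕋3` under the sector frequencies.
Why true / route: (0) `P ∈ 𝒫 ⊆ Z.localObs` (KAlg (a); `φ_0 = id` everywhere by the normal form), `Z.form = Σ_y Cov` (`form_eq_tsum`);
the degree-2 part `P₂` has `‖[P₂]‖₀² = Z.form P₂ P₂ = Re[T₂₀ + T₁₁](P₂,P₂) = ∫|S₂₀P₂|² + ∫|S₁₁P₂|² = 0` by K2 and the hypotheses, and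
`[c₀] = 0`, so `Z.form P (P∘φ_t) = Z.form P₄ (P₄∘φ_t)` (Cauchy–Schwarz in `ℋ₀`: `form u v = ⟪fluct u, fluct v⟫`); (1) for the degree-4
part fix `u = P₄` and consider, for EVERY Wick monomial `v = :φ(h₀)⋯φ(h₃):`, `G_v(t) := Z.form u (v ∘ φ_t) − R_v(t)`,
`R_v(t) = Re[(1/12)∫conj(S₄₀u)S₄₀v e^{itΩ₄₀} + (1/3)∫conj(S₃₁u)S₃₁v e^{itΩ₃₁} + (1/4)∫conj(S₂₂u)S₂₂v e^{itΩ₂₂}]`; (2) `G_v(0) = 0` by K2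
(bilinearity); (3) `G_v` is differentiable with `G_v' = G_{𝓛₀v}`: on the left by the landed generator stub C
(`…GramPencilHarmonicChaos.stub_pencilDerivation` (ii): `HasDerivAt (t ↦ U_t[v]) [𝓛₀v] 0`, transported to every `t` by the group law and
`⟪[u], U_{t+h}[v]⟫ = ⟪U_{−t}[u], U_h[v]⟫`), on the right by differentiating under the integral (bounded continuous integrands on a compact
group) and KAlg (b)+(c): `S_{mn}(𝓛₀v) = iΩ_{mn}·S_{mn}v` (a creation slot carries `conj(−iω w) = +iω conj w`, an annihilation slot `−iω w`);
`𝓛₀v = Σᵢ :⋯φ(Lhᵢ)⋯:` is a combination of `≤ 3·4` Wick monomials of coordinates with coefficients `≤ ω₂ + 2` when the `hᵢ` are coordinate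
test functions, and `v ↦ G_v` is multilinear in the slots; (4) `|G_v(t)| ≤ M` uniformly over coordinate monomials `v` (Cauchy–Schwarz:
`‖[v]‖₀² = Z.form v v` is a shell integral of bounded thermal waves by K2; same for `R_v`); (5) hence `|G_v(t)| ≤ M (12(ω₂+2)|t|)ⁿ/n!` for
all `n` by induction (Gronwall through the closed system), so `G_v ≡ 0`; (6) bilinearity in the presentation gives the polynomial
formula with `Re(|a|² e^{iθ}) = |a|² cos θ` (`Ω₀₄ = −Ω₄₀`, `Ω₁₃ = −Ω₃₁`; complementary sectors are complex conjugate, whence the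
coefficients `1/12, 1/3, 1/4`). Consumed by: the composition (with KΦ's presentation of `Φ` and KT's window). Leans on: K1, K2, KAlg
(hypotheses BY NAME), `stub_pencilDerivation`, `stub_pencilFramework` (only through the hypotheses), `ZeroWavenumberData.{form_eq_tsum,
koopman_fluct, comp_flow_mem}`, `FluctuationDynamics.{inner_fluct_koopman_fluct, koopman}`, `FluctuationStructure.{form_add_left,
form_smul_left, fluct}`, Mathlib `HasDerivAt`, `intervalIntegral`, `MeasureTheory.hasDerivAt_integral_of_dominated_loc_of_deriv_le`,
`Equiv.Perm`, `Finsupp.single`. [cite: Doyon2022, §4.2–4.3 Thm 4.11] [cite: Janson1997, Thm 4.5 (second quantisation of the one-particle group)] [folklore] -/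
def Sig.stub_wickShellDynamic : Prop :=
  Sig.wickShellStaticConclusion → Sig.stub_harmonicPencilAlgebra →
  ∀ ω₂ : ℝ, 0 < ω₂ →
    ∀ (D : InfiniteChainDynamics (pinnedChain ω₂ 0 0 1)) (Z : ZeroWavenumberData (pinnedChain ω₂ 0 0 1) D),
      (pinnedChain ω₂ 0 0 1).IsChainGibbsMeasure 1 Z.μ →
      D.carrier = (pinnedChain ω₂ 0 0 1).bmGood →
      (∀ (t : ℝ) (σ : ChainConfig), σ ∉ (pinnedChain ω₂ 0 0 1).bmGood → D.flow t σ = σ) →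
      Z.toFluctuationDynamics.IsStronglyContinuous →
      Z.localObs = Submodule.span ℝ {w : ChainConfig → ℝ | ∃ u ∈ Algebra.adjoin ℝ (Set.range fun xc : ℤ × Bool => fun σ : ChainConfig => if xc.2 then (σ xc.1).2 else (σ xc.1).1), ∃ s : ℝ, w = u ∘ D.flow s} →
      ∀ (J : ℕ) (c : Fin J → ℝ) (f : Fin J → Fin 4 → TestFn) (J' : ℕ) (d : Fin J' → ℝ) (g : Fin J' → Fin 2 → TestFn) (c₀ : ℝ) (t : ℝ),
        Z.form (fun σ : ChainConfig => (∑ j : Fin J, c j * wick ω₂ 1 4 (f j) σ) + (∑ j : Fin J', d j * wick ω₂ 1 2 (g j) σ) + c₀)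
          ((fun σ : ChainConfig => (∑ j : Fin J, c j * wick ω₂ 1 4 (f j) σ) + (∑ j : Fin J', d j * wick ω₂ 1 2 (g j) σ) + c₀) ∘ D.flow t) =
          (⟪((∑ j : Fin J, (c j : ℂ) • wickVector ω₂ 1 (f j)) + ∑ j : Fin J', (d j : ℂ) • wickVector ω₂ 1 (g j)),
            chaosKoopman ω₂ t ((∑ j : Fin J, (c j : ℂ) • wickVector ω₂ 1 (f j)) + ∑ j : Fin J', (d j : ℂ) • wickVector ω₂ 1 (g j))⟫_ℂ).re

/-- [v5, chaos vocabulary: (α) is stated as the vanishing of the degree-2 chaos vector `Σⱼ dⱼ • wickVector ω₂ 1 gⱼ = 0` in `ChaosSpace` (equivalently: the three continuous kernels `Σⱼ dⱼ wickKernel gⱼ 2 0 / 1 1 / 0 2` vanish identically — `toL2C` is linear on continuous functions and zero iff a.e. zero iff zero for continuous kernels on a Haar space of full support); (β) is stated for the tree's `wickKernel ω₂ 1 f 2 2 κ`, `κ : Shell 2 2`, created momenta `(κ : SectorConfig 2 2).1 0/1`, annihilated `(κ : SectorConfig 2 2).2 0/1` (on the shell `c₀ + c₁ = a₀ + a₁`,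 so `PinnedChainKinetic.vertex a b (c₀, c₁, a₀)` has fourth momentum `a₁` and `sectorPhase ω₂ κ = ω c₀ + ω c₁ − ω a₀ − ω a₁`); since `wickKernel` carries `(2!2!)^{-1/2} = 1/2` and sums over the 24 slot assignments `Fin 2 ⊕ Fin 2 ≃ Fin 4`, the lead's hand value becomes `A = −3/4`.] **KΦ, identities part — `Sig.forceKernelIdentities` (THE WICK PRESENTATION OF THE FIRST-ORDER FORCE `Φ` AND ITS ZERO-MOMENTUM
KERNELS).** For `ω₂ > 0` and couplings `a, b` there are finitely many Wick monomials presenting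
`Φ = (𝓛_{(a,b)} − 𝓛₀) j⁽²⁾₀ + b·𝓛₀ j⁽⁴⁾₀` EXACTLY as a function (`Φ = Σ cⱼ :φφφφ: + Σ dⱼ :φφ: + c₀`, the inverse Wick expansion
`ξ₁ξ₂ξ₃ξ₄ = :ξ₁ξ₂ξ₃ξ₄: + Σ_{a<b} C_{ab} :ξ_cξ_d: + (C₁₂C₃₄ + C₁₃C₂₄ + C₁₄C₂₃)` of the monomials of the landed explicit form
`…StubFreeForceKernelPolynomial.firstOrderForce_apply`, with `Φ = Ψ + b𝓛₀j⁽⁴⁾`, `Ψ = ½ r₀[a(q₀³ + q₁³) + b(r₋₁³ − r₁³)]`,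
`j⁽⁴⁾ = −½(p₀+p₁)r₀³`, `r_x = q_{x+1} − q_x`), such that: (α) NO CHAOS-2 COMPONENT AT ZERO WAVENUMBER — the symmetrised (2,0), (1,1), (0,2)
kernels of the degree-2 part vanish identically on `𝕋` (for `Ψ`: the coefficients `C(r₀,q₀) = −C(r₀,q₁)`, `C(r₀,r₁) = C(r₀,r₋₁)` cancel in
pairs by shift/reflection symmetry of `greenFn`; for `j⁽⁴⁾`: the `p₀` and `p₁` terms cancel, `ic²(2cos k − 2) + ic²(2 − 2cos k) = 0`;
`𝓛₀` preserves the vanishing by KAlg (b),(c)) — in particular NO DRUDE ATOM; (β) THE PAIR KERNEL IS THE BRACKET TIMES THE VERTEX: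
`S₂₂Φ₄(κ) = A·i·[sin](κ)·v_{a,b}(κ)/Π ω + Ω(κ)·(bounded)`, `[sin] = sin k₁ + sin k₂ − sin k₃ − sin k₄`, `v_{a,b} = a + b·bondVertex =
PinnedChainKinetic.vertex a b`, `Πω = ω₁ω₂ω₃ω₄`, `Ω = PinnedChainKinetic.resonanceFn ω₂`, with `A = −3/2 ≠ 0` (exact for `Ψ`: a slot sum
`6[(ρ̄₁−ρ₁) + (ρ̄₂−ρ₂) + (ρ₃−ρ̄₃) + (ρ₄−ρ̄₄)] = −12i[sin]`, `ρ = e^{ik} − 1`, and `Π ρ^{(*)} = bondVertex` on the shell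
(`PinnedChainKinetic.bondVertex`, `vertex_eq_exp_prod` pattern); the remainder is `b·iΩ·S₂₂(j⁽⁴⁾₄)` by KAlg (b),(c), bounded by continuity on
the compact `𝕋3`) — numerically confirmed by lead a1's K worker (kit j021419/j021420: `F_Φ/([f]·vertex·Πn) = −1.5000000000000`, flat weighted
DOS). Sizes: presentation M (finite unfolding of `wick` + `ring`), (α) M, (β) L (sums over `Equiv.Perm (Fin 4)`: `Finset.univ_perm_fin_succ` /
`Equiv.Perm.decomposeFin`). [cite: AokiLukkarinenSpohn2006, §3 eqs. (3.3), (3.15)–(3.17)] [cite: Spohn2006Phonon, §4 eqs. (4.9)–(4.11)] -/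
def Sig.forceKernelIdentities : Prop :=
  ∀ ω₂ a b : ℝ, 0 < ω₂ →
    ∃ (J : ℕ) (c : Fin J → ℝ) (f : Fin J → Fin 4 → TestFn) (J' : ℕ) (d : Fin J' → ℝ) (g : Fin J' → Fin 2 → TestFn) (c₀ : ℝ),
      (∀ σ : ChainConfig, (fun σ : ChainConfig => liouvilleZ (pinnedChain ω₂ a b 1) (fun σ => (pinnedChain ω₂ 0 0 1).bondCurrentZ σ 0) σ - liouvilleZ (pinnedChain ω₂ 0 0 1) (fun σ => (pinnedChain ω₂ 0 0 1).bondCurrentZ σ 0) σ + b * (liouvilleZ (pinnedChain ω₂ 0 0 1) (fun σ => (pinnedChain ω₂ 0 1 1).bondCurrentZ σ 0) σ - liouvilleZ (pinnedChain ω₂ 0 0 1) (fun σ => (pinnedChain ω₂ 0 0 1).bondCurrentZ σ 0) σ)) σ =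
          (fun σ : ChainConfig => (∑ j : Fin J, c j * wick ω₂ 1 4 (f j) σ) + (∑ j : Fin J', d j * wick ω₂ 1 2 (g j) σ) + c₀) σ) ∧
      (∑ j : Fin J', (d j : ℂ) • wickVector ω₂ 1 (g j)) = 0 ∧
      (∃ A : ℝ, A ≠ 0 ∧ ∃ C : ℝ, ∀ κ : Shell 2 2,
          ‖(∑ j : Fin J, (c j : ℂ) * wickKernel ω₂ 1 (f j) 2 2 κ) -
              (A : ℂ) * Complex.I *
                ((sinT ((κ : SectorConfig 2 2).1 0) + sinT ((κ : SectorConfig 2 2).1 1) - sinT ((κ : SectorConfig 2 2).2 0) - sinT ((κ : SectorConfig 2 2).2 1) : ℝ) : ℂ) *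
                (PinnedChainKinetic.vertex a b ((κ : SectorConfig 2 2).1 0, (κ : SectorConfig 2 2).1 1, (κ : SectorConfig 2 2).2 0) : ℂ) /
                ((PinnedChainKinetic.dispersion ω₂ ((κ : SectorConfig 2 2).1 0) * PinnedChainKinetic.dispersion ω₂ ((κ : SectorConfig 2 2).1 1) * PinnedChainKinetic.dispersion ω₂ ((κ : SectorConfig 2 2).2 0) * PinnedChainKinetic.dispersion ω₂ ((κ : SectorConfig 2 2).2 1) : ℝ) : ℂ)‖ ≤
            C * |sectorPhase ω₂ κ|)

/-- **Stub KΦ — `stub_forceKernels` (LEAD c11 RESHAPE of K; size L; algebra; TRUE): KAlg together with the force-kernel identities.** -/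
def Sig.stub_forceKernels : Prop :=
  Sig.stub_harmonicPencilAlgebra ∧ Sig.forceKernelIdentities

/-- [v5, chaos vocabulary: input = degree-4 data `(cⱼ, fⱼ)` with the pair-kernel structure (β) on `Shell 2 2`; output = a finite measure `m` with `∫ cos(xt) dm = Re ⟪Ψ₄, chaosKoopman ω₂ t Ψ₄⟫_ℂ`, `Ψ₄ = Σⱼ cⱼ • wickVector ω₂ 1 fⱼ`, and its window. Route: `m := Σ_{s : cr+an = 4} (sectorPhase)_*(‖Ψ₄ s‖² shellMeasure)` (`lp` inner product = `tsum` over sectors = a finite sum, `wickKernel_of_ne`; per sector `Re ⟪F, e^{itΩ}F⟫_{L²} = ∫ cos(tΩ)‖F‖² dσ = ∫ cos(xt) d((Ω)_*(‖F‖²σ))` — cf. the lead's folder `work/stubs/stub_freeForceKernel_ChaosSpectral.lean`, an unlanded draft in exactly this vocabulary), the far sectors are gapped and do not charge the window (LANDED `…StubFreeForceKernelSectorGap.lean`: `sectorPhase_far_gap`, `restrict_window_sectorSum_eq_pair`, p140375), and the pair sector `Shell 2 2` is transported to `𝕋3` (continuous `AddEquiv`, `measurePreserving_addEquiv`) and then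 to the real cell, where everything below applies verbatim.] **Stub KT — `stub_forceWindow` (LEAD c11 RESHAPE of K; THE WINDOW: THE EXPLICIT HARMONIC SPECTRAL MEASURE OF `[Φ]` HAS NEAR
FREQUENCY `0` A CONTINUOUS DENSITY, POSITIVE AT `0`; datum-free measure theory on top of the sibling crux 12594's LANDED threshold
theorems; size L–XL; TRUE).** Given couplings `a, b > 0` with the odd-sector gap and ANY finite family `(cⱼ, fⱼ)` whose symmetrised pair
kernel obeys (β) of KΦ, the finite positive measure `m := (1/12)(Ω₄₀)_*(|S₄₀P|²μ𝕋3) + (1/3)(Ω₃₁)_*(|S₃₁P|²μ𝕋3) + (1/4)(Ω₂₂)_*(|S₂₂P|²μ𝕋3)`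
on `ℝ` has cosine transform EXACTLY the right side of K6, and on a window `(−δ, δ)` a continuous density `ρ ≥ 0` with `ρ(0) > 0`.
Why true / route: `∫ cos(xt) d(Ω_*(w μ)) = ∫ w cos(tΩ) dμ` (`integral_map`); GAPS: `Ω₄₀ ≥ 4√ω₂` (`PinnedChainKinetic.sqrt_le_dispersion`),
`Ω₃₁ ≥ 8ω₂/(√(9ω₂+36)+√(ω₂+36)) > 0` (LANDED `…StubFreeForceKernelThreeOneGap.dispersion_three_one_gap`, lift to `𝕋` by
`QuotientAddGroup.induction_on`), so for `δ` below the gaps only the pair term charges the window; PAIR TERM: `w := |S₂₂P|²` is continuous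
(`HarmonicChaos.continuous_thermalWave`) and `w ≤ 2A²[sin]²v²/(Πω)² + 2C²Ω² ≤ C_w sin²((k₃−k₁)/2) sin²((k₂−k₃)/2)` on real representatives
(bracket modulus for the `C²` periodic profiles `sin` AND `ω`: `MourreDissolution.stub_bracketModulus` — `Ω = [ω]` is itself a bracket —,
`abs_vertex_le`, `ω ≥ √ω₂`), which is exactly the hypothesis `hw₃` of the LANDED general slab estimate `MourreDissolution.slabNC_core`
(file `…MourreDissolutionSlabNonconcentration.lean`); rerun the landed continuity assembly of 12594 (GLUE `stub_densityApproximation`, PER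
`stub_periodisation`, REG `stub_regularValueDensity stub_monotoneFibreDensity`, the regular-value check via `stub_regularLevels` +
`stub_pairThreshold` as in `MourreDissolution.stub_continuousDensityAssembly` / `contAsm_*`) with `w` in place of `W_f`, after moving
`μ𝕋3` to Lebesgue on the cell `(−π,π]³` (`AddCircle.lintegral_preimage`, factor `(2π)⁻³`; mind the variable order `p = (k₁,(k₃,k₂))` of the
12594 statements: `resonanceFn ω₂ p.1 p.2.2 p.2.1`, a measure-preserving swap); POSITIVITY AT `0`: the Poisson integrals
`P_ν(0) = ∫ w ν/(Ω²+ν²)` converge to `πρ(0)` (`MourreDissolution.stub_poissonLocallyUniform`, B2) and differ from `A²·P_ν(0)[W_{sin}]` by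
`≤ ∫ C'|Ω|ν/(Ω²+ν²) → 0` (dominated convergence; `{Ω = 0}` is null: `PinnedChainResonantFinite.resonantSet_finite` fibrewise + Tonelli),
while `P_ν(0)[W_{sin}] → (4π/alsPrefactor)·q(sin)` (LANDED `MourreDissolution.fermiGoldenRule_threshold` / `thresholdDensity`,
`f = Real.sin`, `C³`, `2π`-periodic) and `q(sin) ≥ g₀‖sin‖² > 0` by `HasOddSectorGap` (`sin` odd, `cellNormSq sin = π`). Consumed by: the
composition. Leans on: the 12594 Theorems files `EmbeddedDrudeMourreMourreDissolution{FreeLevelShift, FermiGoldenRuleThreshold,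
LevelShiftPushforward, PoissonLocallyUniform, DensityApproximation, Periodisation, MonotoneFibreDensity, RegularValueDensity, SlabNonconcentration,
SlabFibre, SlabRegionT1-3, ContinuousDensityAssembly(Aux), RegularLevels, PairThreshold, BracketModulus}`, `PinnedChainKinetic.{vertex, bondVertex_coe,
resonanceFn, dispersion_coe, k₄}`, `PhononBoltzmann.{HasOddSectorGap, boltzmannForm, alsPrefactor}`, Mathlib `Measure.map`, `withDensity`,
`AddCircle.measurePreserving_mk`. [cite: AokiLukkarinenSpohn2006, eqs. (3.17)–(3.20), (4.1), (4.10)–(4.11), (4.16)] -/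
def Sig.stub_forceWindow : Prop :=
  ∀ ω₂ a b : ℝ, 0 < ω₂ → 0 < a → 0 < b → HasOddSectorGap ω₂ a b →
    ∀ (J : ℕ) (c : Fin J → ℝ) (f : Fin J → Fin 4 → TestFn),
      (∃ A : ℝ, A ≠ 0 ∧ ∃ C : ℝ, ∀ κ : Shell 2 2,
          ‖(∑ j : Fin J, (c j : ℂ) * wickKernel ω₂ 1 (f j) 2 2 κ) -
              (A : ℂ) * Complex.I *
                ((sinT ((κ : SectorConfig 2 2).1 0) + sinT ((κ : SectorConfig 2 2).1 1) - sinT ((κ : SectorConfig 2 2).2 0) - sinT ((κ : SectorConfig 2 2).2 1) : ℝ) : ℂ) *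
                (PinnedChainKinetic.vertex a b ((κ : SectorConfig 2 2).1 0, (κ : SectorConfig 2 2).1 1, (κ : SectorConfig 2 2).2 0) : ℂ) /
                ((PinnedChainKinetic.dispersion ω₂ ((κ : SectorConfig 2 2).1 0) * PinnedChainKinetic.dispersion ω₂ ((κ : SectorConfig 2 2).1 1) * PinnedChainKinetic.dispersion ω₂ ((κ : SectorConfig 2 2).2 0) * PinnedChainKinetic.dispersion ω₂ ((κ : SectorConfig 2 2).2 1) : ℝ) : ℂ)‖ ≤
            C * |sectorPhase ω₂ κ|) →
      ∃ m : MeasureTheory.Measure ℝ, MeasureTheory.IsFiniteMeasure m ∧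
        (∀ t : ℝ, ∫ x, Real.cos (x * t) ∂m =
          (⟪(∑ j : Fin J, (c j : ℂ) • wickVector ω₂ 1 (f j)), chaosKoopman ω₂ t (∑ j : Fin J, (c j : ℂ) • wickVector ω₂ 1 (f j))⟫_ℂ).re) ∧
        ∃ δ : ℝ, 0 < δ ∧ ∃ ρ : ℝ → ℝ, ContinuousOn ρ (Set.Ioo (-δ) δ) ∧ (∀ x ∈ Set.Ioo (-δ) δ, 0 ≤ ρ x) ∧ 0 < ρ 0 ∧
          m.restrict (Set.Ioo (-δ) δ) = (volume.restrict (Set.Ioo (-δ) δ)).withDensity (fun x => ENNReal.ofReal (ρ x))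

/-! ## §2 The registered stubs (statements expanded verbatim)

LEAD a1 INTEGRATION (2026-08-17): S `stub_polynomialStationarity` (p133136), C `stub_pencilDerivation` (p134596) and
F `stub_pencilFramework` (p136062), G `stub_gramContinuity` (p136540) have LANDED under `Summits/…/Theorems/EmbeddedDrudeMourreDrudeDissolutionStub*.lean`
(namespace `…Theorems.DrudeDissolution.GramPencilHarmonicChaos`) and are wired in below; `sorry` remains only in
K `stub_freeForceKernel` (reduced to its spectral-window form
`stub_freeForceKernel_of_spectralWindow`, p135265: the residue is the Wick/normal-mode identification of the spectral
measure of `[Φ]` plus a two-phonon threshold density of the kind of stmt-12594's `stub_thresholdDensity`) and the engine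
E `stub_pencilDissolution` (open). -/

/-- **STUB F** (L–XL; framework): the rich symmetric zero-wavenumber datum of `pinnedChain ω₂ lam β 1`
(`lam, β ≥ 0`) at unit temperature, observables = flow-orbit of the local polynomials. -/
theorem stub_pencilFramework :
    ∀ ω₂ lam β : ℝ, 0 < ω₂ → 0 ≤ lam → 0 ≤ β →
      ∃ (D : InfiniteChainDynamics (pinnedChain ω₂ lam β 1))
        (Z : ZeroWavenumberData (pinnedChain ω₂ lam β 1) D),
          (pinnedChain ω₂ lam β 1).IsChainGibbsMeasure 1 Z.μ ∧
          D.carrier = (pinnedChain ω₂ lam β 1).bmGood ∧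
          (∀ t : ℝ, Measurable (D.flow t)) ∧
          (∀ (t : ℝ) (σ : ChainConfig), σ ∉ (pinnedChain ω₂ lam β 1).bmGood → D.flow t σ = σ) ∧
          (∀ (t : ℝ) (x : ℤ), D.flow t ∘ chainShift x = chainShift x ∘ D.flow t) ∧
          (∀ t : ℝ, (fun (σ : ChainConfig) (i : ℤ) => σ (-i)) ∘ D.flow t = D.flow t ∘ (fun (σ : ChainConfig) (i : ℤ) => σ (-i))) ∧
          MeasureTheory.MeasurePreserving (fun (σ : ChainConfig) (i : ℤ) => σ (-i)) Z.μ Z.μ ∧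
          Z.HasMomentumReversal ∧
          Z.toFluctuationDynamics.IsStronglyContinuous ∧
          Z.localObs = Submodule.span ℝ {w : ChainConfig → ℝ | ∃ u ∈ Algebra.adjoin ℝ (Set.range fun xc : ℤ × Bool => fun σ : ChainConfig => if xc.2 then (σ xc.1).2 else (σ xc.1).1), ∃ s : ℝ, w = u ∘ D.flow s} :=
  Summit.AtomisticToContinuum.FouriersLaw.Theorems.DrudeDissolution.GramPencilHarmonicChaos.stub_pencilFramework

/-- **STUB C** (M–L): `liouvilleZ` maps local polynomials to local polynomials, is the Koopman generator
on their classes, and the local classes form a core. -/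
theorem stub_pencilDerivation :
    (∀ ω₂ lam β γ : ℝ, ∀ u ∈ Algebra.adjoin ℝ (Set.range fun xc : ℤ × Bool => fun σ : ChainConfig => if xc.2 then (σ xc.1).2 else (σ xc.1).1),
        liouvilleZ (pinnedChain ω₂ lam β γ) u ∈ Algebra.adjoin ℝ (Set.range fun xc : ℤ × Bool => fun σ : ChainConfig => if xc.2 then (σ xc.1).2 else (σ xc.1).1)) ∧
      ∀ ω₂ lam β : ℝ, 0 < ω₂ → 0 ≤ lam → 0 ≤ β →
        ∀ (D : InfiniteChainDynamics (pinnedChain ω₂ lam β 1)) (Z : ZeroWavenumberData (pinnedChain ω₂ lam β 1) D),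
          (pinnedChain ω₂ lam β 1).IsChainGibbsMeasure 1 Z.μ →
          D.carrier = (pinnedChain ω₂ lam β 1).bmGood →
          (∀ (t : ℝ) (σ : ChainConfig), σ ∉ (pinnedChain ω₂ lam β 1).bmGood → D.flow t σ = σ) →
          Z.toFluctuationDynamics.IsStronglyContinuous →
          Z.localObs = Submodule.span ℝ {w : ChainConfig → ℝ | ∃ u ∈ Algebra.adjoin ℝ (Set.range fun xc : ℤ × Bool => fun σ : ChainConfig => if xc.2 then (σ xc.1).2 else (σ xc.1).1), ∃ s : ℝ, w = u ∘ D.flow s} →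
          (∀ u ∈ Algebra.adjoin ℝ (Set.range fun xc : ℤ × Bool => fun σ : ChainConfig => if xc.2 then (σ xc.1).2 else (σ xc.1).1),
            HasDerivAt (fun t : ℝ => (Z.koopman t (Z.fluct u) : ZeroWavenumberSpace Z))
              (Z.fluct (liouvilleZ (pinnedChain ω₂ lam β 1) u)) 0) ∧
          Z.generator.HasCore
            (Submodule.span ℝ {ψ : ZeroWavenumberSpace Z | ∃ w ∈ Z.localObs, ψ = Z.fluct w}) :=
  Summit.AtomisticToContinuum.FouriersLaw.Theorems.DrudeDissolution.GramPencilHarmonicChaos.stub_pencilDerivation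

/-- **STUB G** (M–L; static): uniform clustering and continuity in the coupling of the Gram form on local
polynomials along the ray at `T = 1`. -/
theorem stub_gramContinuity :
    ∀ ω₂ a b : ℝ, 0 < ω₂ → 0 ≤ a → 0 ≤ b → ∀ μ : ℝ → MeasureTheory.Measure ChainConfig,
      (∀ ε ∈ Set.Icc (0 : ℝ) 1, (pinnedChain ω₂ (a * ε) (b * ε) 1).IsChainGibbsMeasure 1 (μ ε) ∧ IsShiftInvariant (μ ε)) →
      ∀ u ∈ Algebra.adjoin ℝ (Set.range fun xc : ℤ × Bool => fun σ : ChainConfig => if xc.2 then (σ xc.1).2 else (σ xc.1).1),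
      ∀ v ∈ Algebra.adjoin ℝ (Set.range fun xc : ℤ × Bool => fun σ : ChainConfig => if xc.2 then (σ xc.1).2 else (σ xc.1).1),
        (∃ M : ℝ, ∀ ε ∈ Set.Icc (0 : ℝ) 1, MeasureTheory.MemLp u 2 (μ ε) ∧ ∫ σ, (u σ) ^ 2 ∂(μ ε) ≤ M) ∧
        (∃ C : ℝ, ∀ ε ∈ Set.Icc (0 : ℝ) 1,
          Summable (fun x : ℤ => |ProbabilityTheory.covariance u (v ∘ chainShift x) (μ ε)|) ∧
          ∑' x : ℤ, |ProbabilityTheory.covariance u (v ∘ chainShift x) (μ ε)| ≤ C) ∧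
        ContinuousOn (fun ε : ℝ => ∑' x : ℤ, ProbabilityTheory.covariance u (v ∘ chainShift x) (μ ε))
          (Set.Icc (0 : ℝ) 1) :=
  Summit.AtomisticToContinuum.FouriersLaw.Theorems.DrudeDissolution.GramPencilHarmonicChaos.stub_gramContinuity

/-- **STUB S** (M): generator-sense stationarity of shift-invariant DLR states on local polynomials. -/
theorem stub_polynomialStationarity :
    ∀ ω₂ lam β γ T : ℝ, 0 < ω₂ → 0 ≤ lam → 0 ≤ β → 0 < T →
      ∀ μ : MeasureTheory.Measure ChainConfig,
        (pinnedChain ω₂ lam β γ).IsChainGibbsMeasure T μ → IsShiftInvariant μ →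
        ∀ f ∈ Algebra.adjoin ℝ (Set.range fun xc : ℤ × Bool => fun σ : ChainConfig => if xc.2 then (σ xc.1).2 else (σ xc.1).1),
          MeasureTheory.Integrable (liouvilleZ (pinnedChain ω₂ lam β γ) f) μ ∧
          ∫ σ, liouvilleZ (pinnedChain ω₂ lam β γ) f σ ∂μ = 0 :=
  Summit.AtomisticToContinuum.FouriersLaw.Theorems.DrudeDissolution.GramPencilHarmonicChaos.stub_polynomialStationarity

/-- **STUB K1 — CLOSED** (landed p144637 by worker-K1) (L): Stein/Isserlis recursion for the shift-invariant DLR state of the harmonic chain. -/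
theorem stub_harmonicStein :
  ∀ ω₂ γ T : ℝ, 0 < ω₂ → 0 < T → ∀ μ : MeasureTheory.Measure ChainConfig,
    (pinnedChain ω₂ 0 0 γ).IsChainGibbsMeasure T μ → IsShiftInvariant μ →
      (∀ (N : ℕ) (f : Fin N → TestFn), MeasureTheory.Integrable (fun σ : ChainConfig => ∏ i, linObs (f i) σ) μ) ∧
      (∀ f₀ : TestFn, ∫ σ, linObs f₀ σ ∂μ = 0) ∧
      (∀ (N : ℕ) (f₀ : TestFn) (f : Fin (N + 1) → TestFn),
          ∫ σ, linObs f₀ σ * ∏ i, linObs (f i) σ ∂μ =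
            ∑ i : Fin (N + 1), thermalCov ω₂ T f₀ (f i) * ∫ σ, ∏ j : Fin N, linObs (Fin.removeNth i f j) σ ∂μ) :=
  Summit.AtomisticToContinuum.FouriersLaw.Theorems.DrudeDissolution.GramPencilHarmonicChaos.stub_harmonicStein

/-- **STUB K2 — CLOSED** (landed p144120 by the lead, `…Theorems.DrudeDissolution.GramPencilHarmonicChaos.stub_wickShellStatic`): static zero-wavenumber form of Wick monomials as zero-momentum shell integrals. -/
theorem stub_wickShellStatic :
    (∀ ω₂ γ T : ℝ, 0 < ω₂ → 0 < T → ∀ μ : MeasureTheory.Measure ChainConfig,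
    (pinnedChain ω₂ 0 0 γ).IsChainGibbsMeasure T μ → IsShiftInvariant μ →
      (∀ (N : ℕ) (f : Fin N → TestFn), MeasureTheory.Integrable (fun σ : ChainConfig => ∏ i, linObs (f i) σ) μ) ∧
      (∀ f₀ : TestFn, ∫ σ, linObs f₀ σ ∂μ = 0) ∧
      (∀ (N : ℕ) (f₀ : TestFn) (f : Fin (N + 1) → TestFn),
          ∫ σ, linObs f₀ σ * ∏ i, linObs (f i) σ ∂μ =
            ∑ i : Fin (N + 1), thermalCov ω₂ T f₀ (f i) * ∫ σ, ∏ j : Fin N, linObs (Fin.removeNth i f j) σ ∂μ)) →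
  ∀ ω₂ γ : ℝ, 0 < ω₂ → ∀ μ : MeasureTheory.Measure ChainConfig,
    (pinnedChain ω₂ 0 0 γ).IsChainGibbsMeasure 1 μ → IsShiftInvariant μ →
      ∀ (N M : ℕ) (f : Fin N → TestFn) (g : Fin M → TestFn), (N = 2 ∨ N = 4) → (M = 2 ∨ M = 4) →
        Summable (fun y : ℤ => cov[wick ω₂ 1 N f, wick ω₂ 1 M g ∘ chainShift y; μ]) ∧
        ∑' y : ℤ, cov[wick ω₂ 1 N f, wick ω₂ 1 M g ∘ chainShift y; μ] = (⟪wickVector ω₂ 1 f, wickVector ω₂ 1 g⟫_ℂ).re :=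
  Summit.AtomisticToContinuum.FouriersLaw.Theorems.DrudeDissolution.GramPencilHarmonicChaos.stub_wickShellStatic

/-- **STUB KAlg — CLOSED** (landed p142795, `…Theorems.DrudeDissolution.GramPencilHarmonicChaos.stub_harmonicPencilAlgebra`): Leibniz rule of `𝓛₀` on Wick products, `w_{Lf} = −iω w_f`, skewness of the thermal covariance. -/
theorem stub_harmonicPencilAlgebra :
  (∀ (ω₂ T : ℝ) (N : ℕ) (f : Fin N → TestFn), wick ω₂ T N f ∈ Algebra.adjoin ℝ (Set.range fun xc : ℤ × Bool => fun σ : ChainConfig => if xc.2 then (σ xc.1).2 else (σ xc.1).1)) ∧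
  (∀ (ω₂ γ T : ℝ), 0 < ω₂ → ∀ (N : ℕ) (f : Fin N → TestFn) (σ : ChainConfig),
      liouvilleZ (pinnedChain ω₂ 0 0 γ) (wick ω₂ T N f) σ =
        ∑ i : Fin N, wick ω₂ T N (Function.update f i ((-(ω₂ + 2)) • (f i).2 + Finsupp.mapDomain (fun x : ℤ => x + 1) (f i).2 + Finsupp.mapDomain (fun x : ℤ => x - 1) (f i).2, (f i).1)) σ) ∧
  (∀ (ω₂ T : ℝ), 0 < ω₂ → ∀ (f : TestFn) (k : 𝕋),
      thermalWave ω₂ T ((-(ω₂ + 2)) • f.2 + Finsupp.mapDomain (fun x : ℤ => x + 1) f.2 + Finsupp.mapDomain (fun x : ℤ => x - 1) f.2, f.1) k = -Complex.I * (PinnedChainKinetic.dispersion ω₂ k : ℂ) * thermalWave ω₂ T f k) ∧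
  (∀ (ω₂ T : ℝ), 0 < ω₂ → ∀ f g : TestFn,
      thermalCov ω₂ T ((-(ω₂ + 2)) • f.2 + Finsupp.mapDomain (fun x : ℤ => x + 1) f.2 + Finsupp.mapDomain (fun x : ℤ => x - 1) f.2, f.1) g = -thermalCov ω₂ T f ((-(ω₂ + 2)) • g.2 + Finsupp.mapDomain (fun x : ℤ => x + 1) g.2 + Finsupp.mapDomain (fun x : ℤ => x - 1) g.2, g.1)) :=
  Summit.AtomisticToContinuum.FouriersLaw.Theorems.DrudeDissolution.GramPencilHarmonicChaos.stub_harmonicPencilAlgebra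

/-- **STUB K6 — CLOSED** (landed p142630 by worker-K6, `…Theorems.DrudeDissolution.GramPencilHarmonicChaos.stub_wickShellDynamic`): the harmonic spectral formula for Wick polynomials (ODE uniqueness in `ℋ₀`). -/
theorem stub_wickShellDynamic :
    (∀ ω₂ γ : ℝ, 0 < ω₂ → ∀ μ : MeasureTheory.Measure ChainConfig,
    (pinnedChain ω₂ 0 0 γ).IsChainGibbsMeasure 1 μ → IsShiftInvariant μ →
      ∀ (N M : ℕ) (f : Fin N → TestFn) (g : Fin M → TestFn), (N = 2 ∨ N = 4) → (M = 2 ∨ M = 4) →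
        Summable (fun y : ℤ => cov[wick ω₂ 1 N f, wick ω₂ 1 M g ∘ chainShift y; μ]) ∧
        ∑' y : ℤ, cov[wick ω₂ 1 N f, wick ω₂ 1 M g ∘ chainShift y; μ] = (⟪wickVector ω₂ 1 f, wickVector ω₂ 1 g⟫_ℂ).re) →
  ((∀ (ω₂ T : ℝ) (N : ℕ) (f : Fin N → TestFn), wick ω₂ T N f ∈ Algebra.adjoin ℝ (Set.range fun xc : ℤ × Bool => fun σ : ChainConfig => if xc.2 then (σ xc.1).2 else (σ xc.1).1)) ∧
  (∀ (ω₂ γ T : ℝ), 0 < ω₂ → ∀ (N : ℕ) (f : Fin N → TestFn) (σ : ChainConfig),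
      liouvilleZ (pinnedChain ω₂ 0 0 γ) (wick ω₂ T N f) σ =
        ∑ i : Fin N, wick ω₂ T N (Function.update f i ((-(ω₂ + 2)) • (f i).2 + Finsupp.mapDomain (fun x : ℤ => x + 1) (f i).2 + Finsupp.mapDomain (fun x : ℤ => x - 1) (f i).2, (f i).1)) σ) ∧
  (∀ (ω₂ T : ℝ), 0 < ω₂ → ∀ (f : TestFn) (k : 𝕋),
      thermalWave ω₂ T ((-(ω₂ + 2)) • f.2 + Finsupp.mapDomain (fun x : ℤ => x + 1) f.2 + Finsupp.mapDomain (fun x : ℤ => x - 1) f.2, f.1) k = -Complex.I * (PinnedChainKinetic.dispersion ω₂ k : ℂ) * thermalWave ω₂ T f k) ∧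
  (∀ (ω₂ T : ℝ), 0 < ω₂ → ∀ f g : TestFn,
      thermalCov ω₂ T ((-(ω₂ + 2)) • f.2 + Finsupp.mapDomain (fun x : ℤ => x + 1) f.2 + Finsupp.mapDomain (fun x : ℤ => x - 1) f.2, f.1) g = -thermalCov ω₂ T f ((-(ω₂ + 2)) • g.2 + Finsupp.mapDomain (fun x : ℤ => x + 1) g.2 + Finsupp.mapDomain (fun x : ℤ => x - 1) g.2, g.1))) →
  ∀ ω₂ : ℝ, 0 < ω₂ →
    ∀ (D : InfiniteChainDynamics (pinnedChain ω₂ 0 0 1)) (Z : ZeroWavenumberData (pinnedChain ω₂ 0 0 1) D),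
      (pinnedChain ω₂ 0 0 1).IsChainGibbsMeasure 1 Z.μ →
      D.carrier = (pinnedChain ω₂ 0 0 1).bmGood →
      (∀ (t : ℝ) (σ : ChainConfig), σ ∉ (pinnedChain ω₂ 0 0 1).bmGood → D.flow t σ = σ) →
      Z.toFluctuationDynamics.IsStronglyContinuous →
      Z.localObs = Submodule.span ℝ {w : ChainConfig → ℝ | ∃ u ∈ Algebra.adjoin ℝ (Set.range fun xc : ℤ × Bool => fun σ : ChainConfig => if xc.2 then (σ xc.1).2 else (σ xc.1).1), ∃ s : ℝ, w = u ∘ D.flow s} →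
      ∀ (J : ℕ) (c : Fin J → ℝ) (f : Fin J → Fin 4 → TestFn) (J' : ℕ) (d : Fin J' → ℝ) (g : Fin J' → Fin 2 → TestFn) (c₀ : ℝ) (t : ℝ),
        Z.form (fun σ : ChainConfig => (∑ j : Fin J, c j * wick ω₂ 1 4 (f j) σ) + (∑ j : Fin J', d j * wick ω₂ 1 2 (g j) σ) + c₀)
          ((fun σ : ChainConfig => (∑ j : Fin J, c j * wick ω₂ 1 4 (f j) σ) + (∑ j : Fin J', d j * wick ω₂ 1 2 (g j) σ) + c₀) ∘ D.flow t) =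
          (⟪((∑ j : Fin J, (c j : ℂ) • wickVector ω₂ 1 (f j)) + ∑ j : Fin J', (d j : ℂ) • wickVector ω₂ 1 (g j)),
            chaosKoopman ω₂ t ((∑ j : Fin J, (c j : ℂ) • wickVector ω₂ 1 (f j)) + ∑ j : Fin J', (d j : ℂ) • wickVector ω₂ 1 (g j))⟫_ℂ).re :=
  Summit.AtomisticToContinuum.FouriersLaw.Theorems.DrudeDissolution.GramPencilHarmonicChaos.stub_wickShellDynamic

/-- **STUB KΦ — CLOSED** (landed p144578 by worker-KPhi) (L): KAlg and the Wick presentation / zero-momentum kernels of the first-order force `Φ`. -/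
theorem stub_forceKernels :
    ((∀ (ω₂ T : ℝ) (N : ℕ) (f : Fin N → TestFn), wick ω₂ T N f ∈ Algebra.adjoin ℝ (Set.range fun xc : ℤ × Bool => fun σ : ChainConfig => if xc.2 then (σ xc.1).2 else (σ xc.1).1)) ∧
  (∀ (ω₂ γ T : ℝ), 0 < ω₂ → ∀ (N : ℕ) (f : Fin N → TestFn) (σ : ChainConfig),
      liouvilleZ (pinnedChain ω₂ 0 0 γ) (wick ω₂ T N f) σ =
        ∑ i : Fin N, wick ω₂ T N (Function.update f i ((-(ω₂ + 2)) • (f i).2 + Finsupp.mapDomain (fun x : ℤ => x + 1) (f i).2 + Finsupp.mapDomain (fun x : ℤ => x - 1) (f i).2, (f i).1)) σ) ∧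
  (∀ (ω₂ T : ℝ), 0 < ω₂ → ∀ (f : TestFn) (k : 𝕋),
      thermalWave ω₂ T ((-(ω₂ + 2)) • f.2 + Finsupp.mapDomain (fun x : ℤ => x + 1) f.2 + Finsupp.mapDomain (fun x : ℤ => x - 1) f.2, f.1) k = -Complex.I * (PinnedChainKinetic.dispersion ω₂ k : ℂ) * thermalWave ω₂ T f k) ∧
  (∀ (ω₂ T : ℝ), 0 < ω₂ → ∀ f g : TestFn,
      thermalCov ω₂ T ((-(ω₂ + 2)) • f.2 + Finsupp.mapDomain (fun x : ℤ => x + 1) f.2 + Finsupp.mapDomain (fun x : ℤ => x - 1) f.2, f.1) g = -thermalCov ω₂ T f ((-(ω₂ + 2)) • g.2 + Finsupp.mapDomain (fun x : ℤ => x + 1) g.2 + Finsupp.mapDomain (fun x : ℤ => x - 1) g.2, g.1))) ∧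
    (∀ ω₂ a b : ℝ, 0 < ω₂ →
    ∃ (J : ℕ) (c : Fin J → ℝ) (f : Fin J → Fin 4 → TestFn) (J' : ℕ) (d : Fin J' → ℝ) (g : Fin J' → Fin 2 → TestFn) (c₀ : ℝ),
      (∀ σ : ChainConfig, (fun σ : ChainConfig => liouvilleZ (pinnedChain ω₂ a b 1) (fun σ => (pinnedChain ω₂ 0 0 1).bondCurrentZ σ 0) σ - liouvilleZ (pinnedChain ω₂ 0 0 1) (fun σ => (pinnedChain ω₂ 0 0 1).bondCurrentZ σ 0) σ + b * (liouvilleZ (pinnedChain ω₂ 0 0 1) (fun σ => (pinnedChain ω₂ 0 1 1).bondCurrentZ σ 0) σ - liouvilleZ (pinnedChain ω₂ 0 0 1) (fun σ => (pinnedChain ω₂ 0 0 1).bondCurrentZ σ 0) σ)) σ =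
          (fun σ : ChainConfig => (∑ j : Fin J, c j * wick ω₂ 1 4 (f j) σ) + (∑ j : Fin J', d j * wick ω₂ 1 2 (g j) σ) + c₀) σ) ∧
      (∑ j : Fin J', (d j : ℂ) • wickVector ω₂ 1 (g j)) = 0 ∧
      (∃ A : ℝ, A ≠ 0 ∧ ∃ C : ℝ, ∀ κ : Shell 2 2,
          ‖(∑ j : Fin J, (c j : ℂ) * wickKernel ω₂ 1 (f j) 2 2 κ) -
              (A : ℂ) * Complex.I *
                ((sinT ((κ : SectorConfig 2 2).1 0) + sinT ((κ : SectorConfig 2 2).1 1) - sinT ((κ : SectorConfig 2 2).2 0) - sinT ((κ : SectorConfig 2 2).2 1) : ℝ) : ℂ) *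
                (PinnedChainKinetic.vertex a b ((κ : SectorConfig 2 2).1 0, (κ : SectorConfig 2 2).1 1, (κ : SectorConfig 2 2).2 0) : ℂ) /
                ((PinnedChainKinetic.dispersion ω₂ ((κ : SectorConfig 2 2).1 0) * PinnedChainKinetic.dispersion ω₂ ((κ : SectorConfig 2 2).1 1) * PinnedChainKinetic.dispersion ω₂ ((κ : SectorConfig 2 2).2 0) * PinnedChainKinetic.dispersion ω₂ ((κ : SectorConfig 2 2).2 1) : ℝ) : ℂ)‖ ≤
            C * |sectorPhase ω₂ κ|)) :=
  Summit.AtomisticToContinuum.FouriersLaw.Theorems.DrudeDissolution.GramPencilHarmonicChaos.stub_forceKernels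

/-- **STUB KT — CLOSED** (landed p144609 by worker-KT) (L–XL): the explicit spectral measure and its window density, positive at `0`. -/
theorem stub_forceWindow :
    ∀ ω₂ a b : ℝ, 0 < ω₂ → 0 < a → 0 < b → HasOddSectorGap ω₂ a b →
    ∀ (J : ℕ) (c : Fin J → ℝ) (f : Fin J → Fin 4 → TestFn),
      (∃ A : ℝ, A ≠ 0 ∧ ∃ C : ℝ, ∀ κ : Shell 2 2,
          ‖(∑ j : Fin J, (c j : ℂ) * wickKernel ω₂ 1 (f j) 2 2 κ) -
              (A : ℂ) * Complex.I *
                ((sinT ((κ : SectorConfig 2 2).1 0) + sinT ((κ : SectorConfig 2 2).1 1) - sinT ((κ : SectorConfig 2 2).2 0) - sinT ((κ : SectorConfig 2 2).2 1) : ℝ) : ℂ) *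
                (PinnedChainKinetic.vertex a b ((κ : SectorConfig 2 2).1 0, (κ : SectorConfig 2 2).1 1, (κ : SectorConfig 2 2).2 0) : ℂ) /
                ((PinnedChainKinetic.dispersion ω₂ ((κ : SectorConfig 2 2).1 0) * PinnedChainKinetic.dispersion ω₂ ((κ : SectorConfig 2 2).1 1) * PinnedChainKinetic.dispersion ω₂ ((κ : SectorConfig 2 2).2 0) * PinnedChainKinetic.dispersion ω₂ ((κ : SectorConfig 2 2).2 1) : ℝ) : ℂ)‖ ≤
            C * |sectorPhase ω₂ κ|) →
      ∃ m : MeasureTheory.Measure ℝ, MeasureTheory.IsFiniteMeasure m ∧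
        (∀ t : ℝ, ∫ x, Real.cos (x * t) ∂m =
          (⟪(∑ j : Fin J, (c j : ℂ) • wickVector ω₂ 1 (f j)), chaosKoopman ω₂ t (∑ j : Fin J, (c j : ℂ) • wickVector ω₂ 1 (f j))⟫_ℂ).re) ∧
        ∃ δ : ℝ, 0 < δ ∧ ∃ ρ : ℝ → ℝ, ContinuousOn ρ (Set.Ioo (-δ) δ) ∧ (∀ x ∈ Set.Ioo (-δ) δ, 0 ≤ ρ x) ∧ 0 < ρ 0 ∧
          m.restrict (Set.Ioo (-δ) δ) = (volume.restrict (Set.Ioo (-δ) δ)).withDensity (fun x => ENNReal.ofReal (ρ x)) :=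
  Summit.AtomisticToContinuum.FouriersLaw.Theorems.DrudeDissolution.GramPencilHarmonicChaos.stub_forceWindow

/-! ### The composition of K (lead c11): rigidity of the free force kernel + K1 ∧ K2 ∧ KAlg ∧ K6 ∧ KΦ ∧ KT ⇒ K -/

/-- Covariances only see almost-everywhere classes in the second slot. [folklore] -/
theorem covariance_congr_ae_right {μ : MeasureTheory.Measure ChainConfig} {X Y Y' : ChainConfig → ℝ}
    (h : Y =ᵐ[μ] Y') : cov[X, Y; μ] = cov[X, Y'; μ] := by
  unfold ProbabilityTheory.covariance
  have h1 : ∫ ω, Y ω ∂μ = ∫ ω, Y' ω ∂μ := integral_congr_ae h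
  rw [h1]
  refine integral_congr_ae ?_
  filter_upwards [h] with ω hω
  rw [hω]

/-- **Rigidity of the free force kernel (lead c11).** Two zero-wavenumber data of the harmonic chain at `T = 1` over
dynamics with carrier `bmGood` have THE SAME autocorrelation functions on common observables: the state is the unique
shift-invariant DLR state (`OscillatorChain.eq_of_isChainGibbsMeasure_of_isShiftInvariant_pinnedChain`) and the two flows agree on
`bmGood` (uniqueness field of `InfiniteChainDynamics`), a set of full measure. This is what lets stub K quantify over ALL data while
the computation (K6) runs on F's canonical datum. [folklore] -/
theorem form_comp_flow_rigid {ω₂ : ℝ} (hω : 0 < ω₂)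
    {D₀ D : InfiniteChainDynamics (pinnedChain ω₂ 0 0 1)}
    (Z₀ : ZeroWavenumberData (pinnedChain ω₂ 0 0 1) D₀) (Z : ZeroWavenumberData (pinnedChain ω₂ 0 0 1) D)
    (hG₀ : (pinnedChain ω₂ 0 0 1).IsChainGibbsMeasure 1 Z₀.μ) (hG : (pinnedChain ω₂ 0 0 1).IsChainGibbsMeasure 1 Z.μ)
    (hcar₀ : D₀.carrier = (pinnedChain ω₂ 0 0 1).bmGood) (hcar : D.carrier = (pinnedChain ω₂ 0 0 1).bmGood)
    {u : ChainConfig → ℝ} (hu₀ : u ∈ Z₀.localObs) (hu : u ∈ Z.localObs) (t : ℝ) :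
    Z₀.form u (u ∘ D₀.flow t) = Z.form u (u ∘ D.flow t) := by
  -- both states are shift-invariant DLR states at `T = 1`, hence equal
  have hS₀ : IsShiftInvariant Z₀.μ := by
    have h := (Z₀.measurePreserving_shift 1).map_eq
    rwa [chainShift_one] at h
  have hS : IsShiftInvariant Z.μ := by
    have h := (Z.measurePreserving_shift 1).map_eq
    rwa [chainShift_one] at h
  have hμ : Z₀.μ = Z.μ :=
    OscillatorChain.eq_of_isChainGibbsMeasure_of_isShiftInvariant_pinnedChain 1 hω le_rfl le_rfl one_pos hG₀ hS₀ hG hS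
  -- the two flows agree on `bmGood`
  have hflow : ∀ σ ∈ (pinnedChain ω₂ 0 0 1).bmGood, D₀.flow t σ = D.flow t σ := by
    intro σ hσ
    have h0 : σ ∈ D₀.carrier := by rw [hcar₀]; exact hσ
    have h := D.unique (fun s => D₀.flow s σ) (fun s => by rw [hcar, ← hcar₀]; exact D₀.flow_mem h0 s)
      (D₀.isSolution σ h0) t
    simpa only [D₀.flow_zero σ h0] using h
  have hae : (u ∘ D₀.flow t) =ᵐ[Z₀.μ] (u ∘ D.flow t) := by
    filter_upwards [Z₀.ae_mem_carrier] with σ hσ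
    have hσ' : σ ∈ (pinnedChain ω₂ 0 0 1).bmGood := by rw [← hcar₀]; exact hσ
    simp only [comp_apply, hflow σ hσ']
  calc Z₀.form u (u ∘ D₀.flow t)
      = ∑' x : ℤ, cov[u, (u ∘ D₀.flow t) ∘ chainShift x; Z₀.μ] := Z₀.form_eq_tsum hu₀ (Z₀.comp_flow_mem t hu₀)
    _ = ∑' x : ℤ, cov[u, (u ∘ D.flow t) ∘ chainShift x; Z₀.μ] := by
        refine tsum_congr fun x => covariance_congr_ae_right ?_
        exact (Z₀.measurePreserving_shift x).quasiMeasurePreserving.ae_eq_comp hae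
    _ = ∑' x : ℤ, cov[u, (u ∘ D.flow t) ∘ chainShift x; Z.μ] := by rw [hμ]
    _ = Z.form u (u ∘ D.flow t) := (Z.form_eq_tsum hu (Z.comp_flow_mem t hu)).symm

/-- **K from its six sub-stubs (lead c11 reshape; the composition of K).** Reduce to the window clause
(`stub_freeForceKernel_of_windowDensity`, landed); take F's canonical datum at `(0,0)`; move the free force kernel of the given datum to
it (rigidity); present `Φ` by KΦ; evaluate `Z.form Φ (Φ ∘ φ_t)` by K6; KT supplies the measure with that cosine transform and its window. -/
theorem stub_freeForceKernel_of (hK1 : Sig.stub_harmonicStein) (hK2 : Sig.stub_wickShellStatic)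
    (hAlg : Sig.stub_harmonicPencilAlgebra) (hK6 : Sig.stub_wickShellDynamic) (hKΦ : Sig.stub_forceKernels)
    (hKT : Sig.stub_forceWindow) : Sig.stub_freeForceKernel := by
  refine Summit.AtomisticToContinuum.FouriersLaw.Theorems.DrudeDissolution.GramPencilHarmonicChaos.stub_freeForceKernel_of_windowDensity ?_
  intro ω₂ a b hω ha hb hgap D₀ Z₀ hG₀ hcar₀ _hsc₀ hΦ₀ m _hm hK
  -- F's canonical datum of the harmonic chain at `T = 1`
  obtain ⟨D, Z, hG, hcar, -, hid, -, -, -, -, hsc, hobs⟩ :=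
    Summit.AtomisticToContinuum.FouriersLaw.Theorems.DrudeDissolution.GramPencilHarmonicChaos.stub_pencilFramework
      ω₂ 0 0 hω le_rfl le_rfl
  -- KΦ: the Wick presentation of `Φ` and its kernel identities
  obtain ⟨J, c, f, J', d, g, c₀, hpres, hΨ₂, h22⟩ := hKΦ.2 ω₂ a b hω
  -- KT: the explicit measure and its window
  obtain ⟨m', hm', hcos, δ, hδ, ρ, hρc, hρ0, hρ00, hw⟩ := hKT ω₂ a b hω ha hb hgap J c f h22
  refine ⟨m', hm', fun t => ?_, δ, hδ, ρ, hρc, hρ0, hρ00, hw⟩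
  -- K6 on the canonical datum (K2's own K1 premise discharged here); the degree-2 chaos vector is zero (KΦ)
  have hdyn := hK6 (hK2 hK1) hAlg ω₂ hω D Z hG hcar hid hsc hobs J c f J' d g c₀ t
  rw [hΨ₂, add_zero] at hdyn
  rw [hcos t, ← hK t, ← hdyn]
  -- `Φ = P` as functions
  have hΦP := funext hpres
  rw [← hΦP]
  -- `Φ ∈ 𝒫 ⊆ Z.localObs`
  have hP𝒫 : (fun σ : ChainConfig => (∑ j : Fin J, c j * wick ω₂ 1 4 (f j) σ) + (∑ j : Fin J', d j * wick ω₂ 1 2 (g j) σ) + c₀) ∈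
      Algebra.adjoin ℝ (Set.range fun xc : ℤ × Bool => fun σ : ChainConfig => if xc.2 then (σ xc.1).2 else (σ xc.1).1) := by
    set S := Algebra.adjoin ℝ (Set.range fun xc : ℤ × Bool => fun σ : ChainConfig => if xc.2 then (σ xc.1).2 else (σ xc.1).1)
    have hrepr : (fun σ : ChainConfig => (∑ j : Fin J, c j * wick ω₂ 1 4 (f j) σ) + (∑ j : Fin J', d j * wick ω₂ 1 2 (g j) σ) + c₀) =
        (∑ j : Fin J, c j • wick ω₂ 1 4 (f j)) + (∑ j : Fin J', d j • wick ω₂ 1 2 (g j)) + algebraMap ℝ (ChainConfig → ℝ) c₀ := by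
      funext σ
      simp only [Pi.add_apply, Finset.sum_apply, Pi.smul_apply, smul_eq_mul]
      congr 1
    rw [hrepr]
    refine S.add_mem (S.add_mem (S.sum_mem fun j _ => S.smul_mem (hAlg.1 ω₂ 1 4 (f j)) _)
      (S.sum_mem fun j _ => S.smul_mem (hAlg.1 ω₂ 1 2 (g j)) _)) (S.algebraMap_mem c₀)
  have hΦ𝒫 : (fun σ : ChainConfig => liouvilleZ (pinnedChain ω₂ a b 1) (fun σ => (pinnedChain ω₂ 0 0 1).bondCurrentZ σ 0) σ - liouvilleZ (pinnedChain ω₂ 0 0 1) (fun σ => (pinnedChain ω₂ 0 0 1).bondCurrentZ σ 0) σ + b * (liouvilleZ (pinnedChain ω₂ 0 0 1) (fun σ => (pinnedChain ω₂ 0 1 1).bondCurrentZ σ 0) σ - liouvilleZ (pinnedChain ω₂ 0 0 1) (fun σ => (pinnedChain ω₂ 0 0 1).bondCurrentZ σ 0) σ)) ∈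
      Algebra.adjoin ℝ (Set.range fun xc : ℤ × Bool => fun σ : ChainConfig => if xc.2 then (σ xc.1).2 else (σ xc.1).1) := by
    rw [hΦP]; exact hP𝒫
  have hflow0 : D.flow 0 = id := by
    funext σ
    by_cases hσ : σ ∈ (pinnedChain ω₂ 0 0 1).bmGood
    · exact D.flow_zero σ (by rw [hcar]; exact hσ)
    · exact hid 0 σ hσ
  have hΦZ : (fun σ : ChainConfig => liouvilleZ (pinnedChain ω₂ a b 1) (fun σ => (pinnedChain ω₂ 0 0 1).bondCurrentZ σ 0) σ - liouvilleZ (pinnedChain ω₂ 0 0 1) (fun σ => (pinnedChain ω₂ 0 0 1).bondCurrentZ σ 0) σ + b * (liouvilleZ (pinnedChain ω₂ 0 0 1) (fun σ => (pinnedChain ω₂ 0 1 1).bondCurrentZ σ 0) σ - liouvilleZ (pinnedChain ω₂ 0 0 1) (fun σ => (pinnedChain ω₂ 0 0 1).bondCurrentZ σ 0) σ)) ∈ Z.localObs := by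
    rw [hobs]
    refine Submodule.subset_span ⟨_, hΦ𝒫, 0, ?_⟩
    rw [hflow0]; rfl
  exact (form_comp_flow_rigid hω Z₀ Z hG₀ hG hcar₀ hcar hΦ₀ hΦZ t).symm

/-- **STUB K, now a THEOREM modulo its registered sub-stubs** (lead c11 reshape): the free Fermi-golden-rule kernel of the current. -/
theorem stub_freeForceKernel :
    ∀ ω₂ a b : ℝ, 0 < ω₂ → 0 < a → 0 < b → HasOddSectorGap ω₂ a b →
      ∀ (D₀ : InfiniteChainDynamics (pinnedChain ω₂ 0 0 1)) (Z₀ : ZeroWavenumberData (pinnedChain ω₂ 0 0 1) D₀),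
        (pinnedChain ω₂ 0 0 1).IsChainGibbsMeasure 1 Z₀.μ →
        D₀.carrier = (pinnedChain ω₂ 0 0 1).bmGood →
        Z₀.toFluctuationDynamics.IsStronglyContinuous →
        (fun σ : ChainConfig => liouvilleZ (pinnedChain ω₂ a b 1) (fun σ => (pinnedChain ω₂ 0 0 1).bondCurrentZ σ 0) σ - liouvilleZ (pinnedChain ω₂ 0 0 1) (fun σ => (pinnedChain ω₂ 0 0 1).bondCurrentZ σ 0) σ + b * (liouvilleZ (pinnedChain ω₂ 0 0 1) (fun σ => (pinnedChain ω₂ 0 1 1).bondCurrentZ σ 0) σ - liouvilleZ (pinnedChain ω₂ 0 0 1) (fun σ => (pinnedChain ω₂ 0 0 1).bondCurrentZ σ 0) σ)) ∈ Z₀.localObs →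
        ∃ δ : ℝ, 0 < δ ∧ ∃ ρ : ℝ → ℝ, ContinuousOn ρ (Set.Ioo (-δ) δ) ∧ 0 < ρ 0 ∧
          TendstoLocallyUniformlyOn
            (fun (ν : ℝ) (ω : ℝ) => ∫ t in Set.Ioi (0 : ℝ), Real.exp (-(ν * t)) * (Real.cos (ω * t) *
              Z₀.form
                (fun σ : ChainConfig => liouvilleZ (pinnedChain ω₂ a b 1) (fun σ => (pinnedChain ω₂ 0 0 1).bondCurrentZ σ 0) σ - liouvilleZ (pinnedChain ω₂ 0 0 1) (fun σ => (pinnedChain ω₂ 0 0 1).bondCurrentZ σ 0) σ + b * (liouvilleZ (pinnedChain ω₂ 0 0 1) (fun σ => (pinnedChain ω₂ 0 1 1).bondCurrentZ σ 0) σ - liouvilleZ (pinnedChain ω₂ 0 0 1) (fun σ => (pinnedChain ω₂ 0 0 1).bondCurrentZ σ 0) σ))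
                ((fun σ : ChainConfig => liouvilleZ (pinnedChain ω₂ a b 1) (fun σ => (pinnedChain ω₂ 0 0 1).bondCurrentZ σ 0) σ - liouvilleZ (pinnedChain ω₂ 0 0 1) (fun σ => (pinnedChain ω₂ 0 0 1).bondCurrentZ σ 0) σ + b * (liouvilleZ (pinnedChain ω₂ 0 0 1) (fun σ => (pinnedChain ω₂ 0 1 1).bondCurrentZ σ 0) σ - liouvilleZ (pinnedChain ω₂ 0 0 1) (fun σ => (pinnedChain ω₂ 0 0 1).bondCurrentZ σ 0) σ)) ∘ D₀.flow t)))
            (fun ω => Real.pi * ρ ω) (𝓝[>] (0 : ℝ)) (Set.Ioo (-δ) δ) :=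
  stub_freeForceKernel_of stub_harmonicStein stub_wickShellStatic stub_harmonicPencilAlgebra stub_wickShellDynamic
    stub_forceKernels stub_forceWindow

/-- **STUB E** (HARDEST; open): the Abelian limiting absorption principle at frequency `0` for the current
along the ray, from F + C + G + S + K + `HasOddSectorGap`, for `ε < ε₀`. -/
theorem stub_pencilDissolution :
    (∀ ω₂ lam β : ℝ, 0 < ω₂ → 0 ≤ lam → 0 ≤ β →
      ∃ (D : InfiniteChainDynamics (pinnedChain ω₂ lam β 1))
        (Z : ZeroWavenumberData (pinnedChain ω₂ lam β 1) D),
          (pinnedChain ω₂ lam β 1).IsChainGibbsMeasure 1 Z.μ ∧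
          D.carrier = (pinnedChain ω₂ lam β 1).bmGood ∧
          (∀ t : ℝ, Measurable (D.flow t)) ∧
          (∀ (t : ℝ) (σ : ChainConfig), σ ∉ (pinnedChain ω₂ lam β 1).bmGood → D.flow t σ = σ) ∧
          (∀ (t : ℝ) (x : ℤ), D.flow t ∘ chainShift x = chainShift x ∘ D.flow t) ∧
          (∀ t : ℝ, (fun (σ : ChainConfig) (i : ℤ) => σ (-i)) ∘ D.flow t = D.flow t ∘ (fun (σ : ChainConfig) (i : ℤ) => σ (-i))) ∧
          MeasureTheory.MeasurePreserving (fun (σ : ChainConfig) (i : ℤ) => σ (-i)) Z.μ Z.μ ∧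
          Z.HasMomentumReversal ∧
          Z.toFluctuationDynamics.IsStronglyContinuous ∧
          Z.localObs = Submodule.span ℝ {w : ChainConfig → ℝ | ∃ u ∈ Algebra.adjoin ℝ (Set.range fun xc : ℤ × Bool => fun σ : ChainConfig => if xc.2 then (σ xc.1).2 else (σ xc.1).1), ∃ s : ℝ, w = u ∘ D.flow s}) →
    ((∀ ω₂ lam β γ : ℝ, ∀ u ∈ Algebra.adjoin ℝ (Set.range fun xc : ℤ × Bool => fun σ : ChainConfig => if xc.2 then (σ xc.1).2 else (σ xc.1).1),
        liouvilleZ (pinnedChain ω₂ lam β γ) u ∈ Algebra.adjoin ℝ (Set.range fun xc : ℤ × Bool => fun σ : ChainConfig => if xc.2 then (σ xc.1).2 else (σ xc.1).1)) ∧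
      ∀ ω₂ lam β : ℝ, 0 < ω₂ → 0 ≤ lam → 0 ≤ β →
        ∀ (D : InfiniteChainDynamics (pinnedChain ω₂ lam β 1)) (Z : ZeroWavenumberData (pinnedChain ω₂ lam β 1) D),
          (pinnedChain ω₂ lam β 1).IsChainGibbsMeasure 1 Z.μ →
          D.carrier = (pinnedChain ω₂ lam β 1).bmGood →
          (∀ (t : ℝ) (σ : ChainConfig), σ ∉ (pinnedChain ω₂ lam β 1).bmGood → D.flow t σ = σ) →
          Z.toFluctuationDynamics.IsStronglyContinuous →
          Z.localObs = Submodule.span ℝ {w : ChainConfig → ℝ | ∃ u ∈ Algebra.adjoin ℝ (Set.range fun xc : ℤ × Bool => fun σ : ChainConfig => if xc.2 then (σ xc.1).2 else (σ xc.1).1), ∃ s : ℝ, w = u ∘ D.flow s} →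
          (∀ u ∈ Algebra.adjoin ℝ (Set.range fun xc : ℤ × Bool => fun σ : ChainConfig => if xc.2 then (σ xc.1).2 else (σ xc.1).1),
            HasDerivAt (fun t : ℝ => (Z.koopman t (Z.fluct u) : ZeroWavenumberSpace Z))
              (Z.fluct (liouvilleZ (pinnedChain ω₂ lam β 1) u)) 0) ∧
          Z.generator.HasCore
            (Submodule.span ℝ {ψ : ZeroWavenumberSpace Z | ∃ w ∈ Z.localObs, ψ = Z.fluct w})) →
    (∀ ω₂ a b : ℝ, 0 < ω₂ → 0 ≤ a → 0 ≤ b → ∀ μ : ℝ → MeasureTheory.Measure ChainConfig,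
      (∀ ε ∈ Set.Icc (0 : ℝ) 1, (pinnedChain ω₂ (a * ε) (b * ε) 1).IsChainGibbsMeasure 1 (μ ε) ∧ IsShiftInvariant (μ ε)) →
      ∀ u ∈ Algebra.adjoin ℝ (Set.range fun xc : ℤ × Bool => fun σ : ChainConfig => if xc.2 then (σ xc.1).2 else (σ xc.1).1),
      ∀ v ∈ Algebra.adjoin ℝ (Set.range fun xc : ℤ × Bool => fun σ : ChainConfig => if xc.2 then (σ xc.1).2 else (σ xc.1).1),
        (∃ M : ℝ, ∀ ε ∈ Set.Icc (0 : ℝ) 1, MeasureTheory.MemLp u 2 (μ ε) ∧ ∫ σ, (u σ) ^ 2 ∂(μ ε) ≤ M) ∧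
        (∃ C : ℝ, ∀ ε ∈ Set.Icc (0 : ℝ) 1,
          Summable (fun x : ℤ => |ProbabilityTheory.covariance u (v ∘ chainShift x) (μ ε)|) ∧
          ∑' x : ℤ, |ProbabilityTheory.covariance u (v ∘ chainShift x) (μ ε)| ≤ C) ∧
        ContinuousOn (fun ε : ℝ => ∑' x : ℤ, ProbabilityTheory.covariance u (v ∘ chainShift x) (μ ε))
          (Set.Icc (0 : ℝ) 1)) →
    (∀ ω₂ lam β γ T : ℝ, 0 < ω₂ → 0 ≤ lam → 0 ≤ β → 0 < T →
      ∀ μ : MeasureTheory.Measure ChainConfig,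
        (pinnedChain ω₂ lam β γ).IsChainGibbsMeasure T μ → IsShiftInvariant μ →
        ∀ f ∈ Algebra.adjoin ℝ (Set.range fun xc : ℤ × Bool => fun σ : ChainConfig => if xc.2 then (σ xc.1).2 else (σ xc.1).1),
          MeasureTheory.Integrable (liouvilleZ (pinnedChain ω₂ lam β γ) f) μ ∧
          ∫ σ, liouvilleZ (pinnedChain ω₂ lam β γ) f σ ∂μ = 0) →
    (∀ ω₂ a b : ℝ, 0 < ω₂ → 0 < a → 0 < b → HasOddSectorGap ω₂ a b →
      ∀ (D₀ : InfiniteChainDynamics (pinnedChain ω₂ 0 0 1)) (Z₀ : ZeroWavenumberData (pinnedChain ω₂ 0 0 1) D₀),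
        (pinnedChain ω₂ 0 0 1).IsChainGibbsMeasure 1 Z₀.μ →
        D₀.carrier = (pinnedChain ω₂ 0 0 1).bmGood →
        Z₀.toFluctuationDynamics.IsStronglyContinuous →
        (fun σ : ChainConfig => liouvilleZ (pinnedChain ω₂ a b 1) (fun σ => (pinnedChain ω₂ 0 0 1).bondCurrentZ σ 0) σ - liouvilleZ (pinnedChain ω₂ 0 0 1) (fun σ => (pinnedChain ω₂ 0 0 1).bondCurrentZ σ 0) σ + b * (liouvilleZ (pinnedChain ω₂ 0 0 1) (fun σ => (pinnedChain ω₂ 0 1 1).bondCurrentZ σ 0) σ - liouvilleZ (pinnedChain ω₂ 0 0 1) (fun σ => (pinnedChain ω₂ 0 0 1).bondCurrentZ σ 0) σ)) ∈ Z₀.localObs →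
        ∃ δ : ℝ, 0 < δ ∧ ∃ ρ : ℝ → ℝ, ContinuousOn ρ (Set.Ioo (-δ) δ) ∧ 0 < ρ 0 ∧
          TendstoLocallyUniformlyOn
            (fun (ν : ℝ) (ω : ℝ) => ∫ t in Set.Ioi (0 : ℝ), Real.exp (-(ν * t)) * (Real.cos (ω * t) *
              Z₀.form
                (fun σ : ChainConfig => liouvilleZ (pinnedChain ω₂ a b 1) (fun σ => (pinnedChain ω₂ 0 0 1).bondCurrentZ σ 0) σ - liouvilleZ (pinnedChain ω₂ 0 0 1) (fun σ => (pinnedChain ω₂ 0 0 1).bondCurrentZ σ 0) σ + b * (liouvilleZ (pinnedChain ω₂ 0 0 1) (fun σ => (pinnedChain ω₂ 0 1 1).bondCurrentZ σ 0) σ - liouvilleZ (pinnedChain ω₂ 0 0 1) (fun σ => (pinnedChain ω₂ 0 0 1).bondCurrentZ σ 0) σ))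
                ((fun σ : ChainConfig => liouvilleZ (pinnedChain ω₂ a b 1) (fun σ => (pinnedChain ω₂ 0 0 1).bondCurrentZ σ 0) σ - liouvilleZ (pinnedChain ω₂ 0 0 1) (fun σ => (pinnedChain ω₂ 0 0 1).bondCurrentZ σ 0) σ + b * (liouvilleZ (pinnedChain ω₂ 0 0 1) (fun σ => (pinnedChain ω₂ 0 1 1).bondCurrentZ σ 0) σ - liouvilleZ (pinnedChain ω₂ 0 0 1) (fun σ => (pinnedChain ω₂ 0 0 1).bondCurrentZ σ 0) σ)) ∘ D₀.flow t)))
            (fun ω => Real.pi * ρ ω) (𝓝[>] (0 : ℝ)) (Set.Ioo (-δ) δ)) →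
    ∀ ω₂ a b : ℝ, 0 < ω₂ → 0 < a → 0 < b → HasOddSectorGap ω₂ a b →
      ∃ ε₀ : ℝ, 0 < ε₀ ∧ ∀ ε : ℝ, 0 < ε → ε < ε₀ →
        ∀ (D : InfiniteChainDynamics (pinnedChain ω₂ (a * ε) (b * ε) 1))
          (Z : ZeroWavenumberData (pinnedChain ω₂ (a * ε) (b * ε) 1) D),
            (pinnedChain ω₂ (a * ε) (b * ε) 1).IsChainGibbsMeasure 1 Z.μ →
            D.carrier = (pinnedChain ω₂ (a * ε) (b * ε) 1).bmGood →
            (∀ t : ℝ, Measurable (D.flow t)) →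
            (∀ (t : ℝ) (σ : ChainConfig), σ ∉ (pinnedChain ω₂ (a * ε) (b * ε) 1).bmGood → D.flow t σ = σ) →
            (∀ (t : ℝ) (x : ℤ), D.flow t ∘ chainShift x = chainShift x ∘ D.flow t) →
            (∀ t : ℝ, (fun (σ : ChainConfig) (i : ℤ) => σ (-i)) ∘ D.flow t = D.flow t ∘ (fun (σ : ChainConfig) (i : ℤ) => σ (-i))) →
            MeasureTheory.MeasurePreserving (fun (σ : ChainConfig) (i : ℤ) => σ (-i)) Z.μ Z.μ →
            Z.HasMomentumReversal →
            Z.toFluctuationDynamics.IsStronglyContinuous →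
            Z.localObs = Submodule.span ℝ {w : ChainConfig → ℝ | ∃ u ∈ Algebra.adjoin ℝ (Set.range fun xc : ℤ × Bool => fun σ : ChainConfig => if xc.2 then (σ xc.1).2 else (σ xc.1).1), ∃ s : ℝ, w = u ∘ D.flow s} →
            ∃ δ : ℝ, 0 < δ ∧ ∃ g : ℝ → ℝ, ContinuousOn g (Set.Ioo (-δ) δ) ∧ 0 < g 0 ∧
              TendstoLocallyUniformlyOn
                (fun (ν : ℝ) (ω : ℝ) => ∫ t in Set.Ioi (0 : ℝ),
                  Real.exp (-(ν * t)) * (Real.cos (ω * t) * D.currentCorrelation Z.μ t))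
                (fun ω => Real.pi * g ω) (𝓝[>] (0 : ℝ)) (Set.Ioo (-δ) δ) := by
  sorry

/-! ## §3 The composition — the six stub statements conclude the crux BY NAME (kernel-checked, no `sorry`
of its own; this is the ONLY declaration of the file whose conclusion is the crux decl) -/

/-- **THE SKELETON THEOREM.** `Sig.E → DrudeDissolution` (v4: K is the theorem `stub_freeForceKernel` modulo its six registered
sub-stubs and is used inside; v3 was `Sig.K → Sig.E → DrudeDissolution`; the landed F, C, G, S are discharged inside;
v1 was `Sig.F → Sig.C → Sig.G → Sig.S → Sig.K → Sig.E → DrudeDissolution`).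
Pure logic plus landed tree theorems: rewrite the crux into its weak-anharmonicity form
(`Negative.drudeDissolution_iff_weak_anharmonicity`: unit temperature, coupling ray `(aε, bε)`, `γ = 1`);
the odd-sector gap at `(ω₂, a, b)` is the PROVED `FGRGap_proof`; E (fed F, C, G, S, K and the gap) yields
`ε₀`; for `ε < ε₀`, F at `(aε, bε)` yields the datum `(D, Z)`, on which E gives the locally uniform Abelian
limit near `0` with a continuous `g`, `g 0 > 0`; `C_ε = ⟪[J], U_t[J]⟫₀` is continuous (strong continuity),
even (`currentCorrelation_neg`) and positive-definite (`sum_mul_currentCorrelation_nonneg`), so the landed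
Bochner–Stieltjes window lemma `MourreDissolution.stub_spectralWindow` converts the Abelian LAP into
`(σ, δ, g)`; `μ := Z.μ`, preservation and absolute convergence of correlations are `Z.preservesMeasure`,
`Z.hasAbsConvergentCorrelation`. -/
theorem DrudeDissolution_of :
    Sig.stub_pencilDissolution →
        Summit.AtomisticToContinuum.FouriersLaw.Theses.EmbeddedDrudeMourre.DrudeDissolution := by
  intro hE
  -- K is a THEOREM modulo its six registered sub-stubs (lead c11 reshape, `stub_freeForceKernel_of`)
  have hK : Sig.stub_freeForceKernel := stub_freeForceKernel
  have hG : Sig.stub_gramContinuity :=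
    Summit.AtomisticToContinuum.FouriersLaw.Theorems.DrudeDissolution.GramPencilHarmonicChaos.stub_gramContinuity
  -- the landed stubs F, C, S (lead a1 integration; `Sig.*` unfold to the landed statements)
  have hF : Sig.stub_pencilFramework :=
    Summit.AtomisticToContinuum.FouriersLaw.Theorems.DrudeDissolution.GramPencilHarmonicChaos.stub_pencilFramework
  have hC : Sig.stub_pencilDerivation :=
    Summit.AtomisticToContinuum.FouriersLaw.Theorems.DrudeDissolution.GramPencilHarmonicChaos.stub_pencilDerivation
  have hS : Sig.stub_polynomialStationarity :=
    Summit.AtomisticToContinuum.FouriersLaw.Theorems.DrudeDissolution.GramPencilHarmonicChaos.stub_polynomialStationarity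
  rw [Summit.AtomisticToContinuum.FouriersLaw.Theorems.DrudeDissolution.Negative.drudeDissolution_iff_weak_anharmonicity]
  intro ω₂ a b hω ha hb
  -- the Fermi-golden-rule input of the route is PROVED (crux FGRGap, stmt-12595)
  have hgap : HasOddSectorGap ω₂ a b :=
    Summit.AtomisticToContinuum.FouriersLaw.Theorems.FGRGap_proof ω₂ a b hω ha hb
  obtain ⟨ε₀, hε₀, hcore⟩ := hE hF hC hG hS hK ω₂ a b hω ha hb hgap
  refine ⟨ε₀, hε₀, fun ε hε hεlt => ?_⟩
  -- the pencil's datum at coupling (aε, bε), unit temperature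
  obtain ⟨D, Z, hGibbs, hcar, hmeas, hid, hsh, hιflow, hιμ, hR, hsc, hobs⟩ :=
    hF ω₂ (a * ε) (b * ε) hω (mul_pos ha hε).le (mul_pos hb hε).le
  obtain ⟨δ, hδ, g, hg, hg0, hconv⟩ :=
    hcore ε hε hεlt D Z hGibbs hcar hmeas hid hsh hιflow hιμ hR hsc hobs
  -- the current autocorrelation is continuous, even and positive-definite (tree, Bochner inputs)
  have hmean := Z.integral_bondCurrent_eq_zero hR
  have hkoop : Continuous fun t : ℝ => Z.koopman t Z.currentClass := hsc Z.currentClass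
  have hinner : Continuous fun t : ℝ => ⟪Z.currentClass, Z.koopman t Z.currentClass⟫_ℝ :=
    continuous_const.inner hkoop
  have hCcont : Continuous (D.currentCorrelation Z.μ) := by
    have h := hinner
    simp_rw [Z.inner_currentClass_koopman_eq_currentCorrelation' hR] at h
    exact h
  have heven : ∀ t : ℝ, D.currentCorrelation Z.μ (-t) = D.currentCorrelation Z.μ t :=
    fun t => Z.currentCorrelation_neg hR t
  have hpd : ∀ (n : ℕ) (c τ : Fin n → ℝ),
      0 ≤ ∑ i, ∑ j, c i * c j * D.currentCorrelation Z.μ (τ j - τ i) :=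
    fun n c τ => Z.sum_mul_currentCorrelation_nonneg hR Finset.univ c τ
  obtain ⟨σ, hfin, hcos, hgnn, hwin⟩ :=
    Summit.AtomisticToContinuum.FouriersLaw.Theorems.MourreDissolution.stub_spectralWindow
      (D.currentCorrelation Z.μ) hCcont heven hpd δ hδ g hg hconv
  exact ⟨Z.μ, D, hGibbs, Z.preservesMeasure, fun t => Z.hasAbsConvergentCorrelation hmean t,
    σ, hfin, hcos, δ, g, hδ, hg, hgnn, hg0, hwin⟩

/-- The skeleton instantiated through the sorried stubs (an `example`: it registers nothing and leaves
`DrudeDissolution_of` the unique crux-concluding declaration). -/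
example : Summit.AtomisticToContinuum.FouriersLaw.Theses.EmbeddedDrudeMourre.DrudeDissolution :=
  DrudeDissolution_of stub_pencilDissolution

/-! ## §4 Sanity checks (`example`s: proved, register nothing)

The pencil is EXACTLY affine in the coupling at the level of the data entering `liouvilleZ` (the forces)
and `bondCurrentZ` (the current): `𝓛_ε = 𝓛₀ + ε(𝓛_{(a,b)} − 𝓛₀)` termwise and `j^ε = j⁽²⁾ + εb j⁽⁴⁾`. -/

/-- Derivative of the pinning potential of `pinnedChain`. -/
theorem deriv_U_pinnedChain (ω₂ lam β γ q : ℝ) :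
    deriv (pinnedChain ω₂ lam β γ).U q = ω₂ * q + lam * q ^ 3 := by
  have h : HasDerivAt (fun q : ℝ => ω₂ * q ^ 2 / 2 + lam * q ^ 4 / 4)
      (ω₂ * ((2 : ℕ) * q ^ (2 - 1)) / 2 + lam * ((4 : ℕ) * q ^ (4 - 1)) / 4) q :=
    (((hasDerivAt_pow 2 q).const_mul ω₂).div_const 2).add
      (((hasDerivAt_pow 4 q).const_mul lam).div_const 4)
  rw [show (pinnedChain ω₂ lam β γ).U = fun q : ℝ => ω₂ * q ^ 2 / 2 + lam * q ^ 4 / 4 from rfl, h.deriv]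
  push_cast
  ring

/-- Derivative of the interaction potential of `pinnedChain`. -/
theorem deriv_V_pinnedChain (ω₂ lam β γ r : ℝ) :
    deriv (pinnedChain ω₂ lam β γ).V r = r + β * r ^ 3 := by
  have h : HasDerivAt (fun r : ℝ => r ^ 2 / 2 + β * r ^ 4 / 4)
      ((2 : ℕ) * r ^ (2 - 1) / 2 + β * ((4 : ℕ) * r ^ (4 - 1)) / 4) r :=
    ((hasDerivAt_pow 2 r).div_const 2).add (((hasDerivAt_pow 4 r).const_mul β).div_const 4)
  rw [show (pinnedChain ω₂ lam β γ).V = fun r : ℝ => r ^ 2 / 2 + β * r ^ 4 / 4 from rfl, h.deriv]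
  push_cast
  ring

/-- **The forces of the ray are exactly affine in `ε`**: `F^{(aε,bε)}_i = F^{(0,0)}_i + ε (F^{(a,b)}_i − F^{(0,0)}_i)`
— the coefficient functions of `liouvilleZ (pinnedChain ω₂ (aε) (bε) γ)` are those of the pencil
`𝓛₀ + ε𝓛₁`, `𝓛₁ = liouvilleZ (pinnedChain ω₂ a b γ) − liouvilleZ (pinnedChain ω₂ 0 0 γ)` (termwise). -/
example (ω₂ a b γ ε : ℝ) (σ : ChainConfig) (i : ℤ) :
    (pinnedChain ω₂ (a * ε) (b * ε) γ).force σ i =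
      (pinnedChain ω₂ 0 0 γ).force σ i +
        ε * ((pinnedChain ω₂ a b γ).force σ i - (pinnedChain ω₂ 0 0 γ).force σ i) := by
  simp only [OscillatorChain.force, OscillatorChain.interactionForce, deriv_U_pinnedChain,
    deriv_V_pinnedChain]
  ring

/-- The summands of `liouvilleZ` along the ray are those of `𝓛₀ + ε𝓛₁` (before the site sum). -/
example (ω₂ a b γ ε : ℝ) (f : ChainConfig → ℝ) (σ : ChainConfig) (x : ℤ) :
    (σ x).2 * partialQZ x f σ + (pinnedChain ω₂ (a * ε) (b * ε) γ).force σ x * partialPZ x f σ =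
      ((σ x).2 * partialQZ x f σ + (pinnedChain ω₂ 0 0 γ).force σ x * partialPZ x f σ) +
        ε * (((pinnedChain ω₂ a b γ).force σ x - (pinnedChain ω₂ 0 0 γ).force σ x) *
          partialPZ x f σ) := by
  simp only [OscillatorChain.force, OscillatorChain.interactionForce, deriv_U_pinnedChain,
    deriv_V_pinnedChain]
  ring

/-- **The current of the ray is exactly affine in `ε`**: `j^{(·,bε)}_x = j⁽²⁾_x + ε b j⁽⁴⁾_x` with
`j⁽²⁾ = bondCurrentZ (pinnedChain ω₂ 0 0 γ)` and `j⁽⁴⁾ = bondCurrentZ (pinnedChain ω₂ 0 1 γ) − j⁽²⁾` (the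
normalisation used in stub K's force `Φ`). -/
example (ω₂ lam b γ ε : ℝ) (σ : ChainConfig) (x : ℤ) :
    (pinnedChain ω₂ lam (b * ε) γ).bondCurrentZ σ x =
      (pinnedChain ω₂ 0 0 γ).bondCurrentZ σ x +
        ε * (b * ((pinnedChain ω₂ 0 1 γ).bondCurrentZ σ x - (pinnedChain ω₂ 0 0 γ).bondCurrentZ σ x)) := by
  simp only [OscillatorChain.bondCurrentZ, deriv_V_pinnedChain]
  ring

/-- The hypotheses of the window lemma are available for every datum with momentum-reversal symmetry:
`C` is even and positive-definite (tree), in exactly the spelling used by the composition. -/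
example {ω₂ lam β : ℝ} {D : InfiniteChainDynamics (pinnedChain ω₂ lam β 1)}
    (Z : ZeroWavenumberData (pinnedChain ω₂ lam β 1) D) (hR : Z.HasMomentumReversal) :
    (∀ t : ℝ, D.currentCorrelation Z.μ (-t) = D.currentCorrelation Z.μ t) ∧
      ∀ (n : ℕ) (c τ : Fin n → ℝ), 0 ≤ ∑ i, ∑ j, c i * c j * D.currentCorrelation Z.μ (τ j - τ i) :=
  ⟨fun t => Z.currentCorrelation_neg hR t, fun _ c τ => Z.sum_mul_currentCorrelation_nonneg hR Finset.univ c τ⟩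

/-- The harmonic endpoint of the ray is literally the chain of stub K (`a·0 = b·0 = 0`). -/
example (ω₂ a b : ℝ) : pinnedChain ω₂ (a * 0) (b * 0) 1 = pinnedChain ω₂ 0 0 1 := by
  simp only [mul_zero]

end Summit.AtomisticToContinuum.FouriersLaw.Cruxes.DrudeDissolution.GramPencilHarmonicChaos

end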